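import Mathlib.Analysis.SpecialFunctions.Pow.Real
import HarnessLib

/-!
# Pebody's coupling theorem (the distribution theorem behind the KSS lower bound)

L. Pebody, *Proof of a conjecture of Kleinberg–Sawin–Speyer*, Discrete Analysis 2018:13
(arXiv:1608.05740, held: `paper:arxiv-1608.05740`), Theorem 4: "If three discrete non-negative
integer-valued probability distributions are decreasing, only take values in
`[p] = {0, 1, …, p−1}` and have expected values summing to `p − 1` then they are compatible", i.e.
there are dependent random variables `X₁, X₂, X₃` with these laws and `X₁ + X₂ + X₃ = p − 1`.
Applied to three copies of the geometric distribution `ψ_ρ` this is Kleinberg–Sawin–Speyer 2018,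
Theorem 4 ([Norin], [Pebody]) — the input of the lower-bound construction of KSS §4, formalised in
`TricoloredSumFreeLowerBoundProofs.lean`. Everything here is PROVED; the file introduces no
definition (the bookkeeping predicates are local notations).

## Rendering

Distributions are unnormalised: `f : ℕ → ℝ` decreasing (`Antitone`) and vanishing above `m`
(`m = p − 1`), so `f ≥ 0`; `Mass[m, f] = Σ_{k≤m} f k`, `Mom[m, f] = Σ_{k≤m} k f k`. A triple is
*admissible* (`Adm[m, f₁, f₂, f₃]`) when the masses agree and the moments sum to `m ·` mass, and a
*coupling* (`Cpl[m, f₁, f₂, f₃, w]`) is a weight `w ≥ 0` on `ℕ³` supported on `a + b + c = m` with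
marginals `f₁, f₂, f₃`. Main statement: `Pebody.theorem4`; the KSS form is
`Pebody.exists_coupling_of_antitone`.

## Structure (mirrors the paper)

* toolkit: couplings form a convex cone stable under permuting and shifting coordinates
  (`cpl_add`, `cpl_sum`, `cpl_point`, `cpl_swap12/23/13`, `cpl_shift1/2/3`).
* **Lemma 9** (`lemma9`): `U_a`, `U_b` coupled with `U_{a+b}`-distributed sum. DEVIATION: the
  printed proof samples i.i.d. continuous variables; we use the exact recursion
  `C(a,b) = (δ₀₀ + a·[(1,0)+C(a−1,b)] + b·[(0,1)+C(a,b−1)])/(a+b+1)`.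
* **Corollary 10** (`cor10`) and the §5 case `(U_m, U_m, δ₀)` (`cpl_uniform_uniform_zero`).
* **Lemma 7** (`sum_two_mul_sub_mul_nonpos`, `lemma7_bound`, `lemma7_cross`) and
  **Corollary 8** (`cor8`, the induction step; the cap `x` by the intermediate value theorem).
* **Lemma 5 / Corollary 6** (`stepB_core`, `stepB`): reduction to simple triples
  `(U_k, U_l, λU_y + (1−λ)U_z)` by peeling along the jumps (induction on the number of jumps);
  simple triples are compatible by `simple_of_cor8` (Cor. 8 when at most one distribution charges
  the top, otherwise `simple_charging`: §5 / Lemma 9 / Cor. 10).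
* **Theorem 4** (`theorem4`) by induction on `m` (§5).

## References

* [Peabody2018] L. Pebody, Discrete Analysis 2018:13, arXiv:1608.05740: Thm. 4, Lemma 5, Cor. 6
  (p. 4 of the held text), Lemma 7, Cor. 8 (p. 5), Lemma 9, Cor. 10 (p. 6), §5 (p. 7).
* [KleinbergSawinSpeyer2018] R. Kleinberg, W. Sawin, D. Speyer, Discrete Analysis 2018:12, §3
  Thm. 4.
* S. Norin, *A distribution on triples with maximum entropy marginal*, Forum Math. Sigma 7 (2019),
  arXiv:1608.00243 (an explicit construction; not used).
-/

noncomputable section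

open Finset

namespace Literature.Combinatorics.Additive

namespace Pebody

set_option quotPrecheck false in
/-- `Cpl[m, f₁, f₂, f₃, w]`: `w ≥ 0` is supported on triples `a + b + c = m` and has marginals
`f₁, f₂, f₃` (sums over the box `[0, m]²`). -/
local notation "Cpl[" m ", " f₁ ", " f₂ ", " f₃ ", " w "]" =>
  ((∀ a b c : ℕ, (0:ℝ) ≤ w a b c) ∧ (∀ a b c : ℕ, a + b + c ≠ m → w a b c = 0) ∧
    (∀ a : ℕ, ∑ b ∈ Finset.range (m + 1), ∑ c ∈ Finset.range (m + 1), w a b c = f₁ a) ∧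
    (∀ b : ℕ, ∑ a ∈ Finset.range (m + 1), ∑ c ∈ Finset.range (m + 1), w a b c = f₂ b) ∧
    (∀ c : ℕ, ∑ a ∈ Finset.range (m + 1), ∑ b ∈ Finset.range (m + 1), w a b c = f₃ c))

/-- Change the marginals pointwise. [folklore] -/
theorem cpl_congr {m : ℕ} {f₁ f₂ f₃ g₁ g₂ g₃ : ℕ → ℝ} {w : ℕ → ℕ → ℕ → ℝ}
    (h : Cpl[m, f₁, f₂, f₃, w]) (h₁ : ∀ k, f₁ k = g₁ k) (h₂ : ∀ k, f₂ k = g₂ k)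
    (h₃ : ∀ k, f₃ k = g₃ k) : Cpl[m, g₁, g₂, g₃, w] := by
  obtain ⟨h0, hs, hm₁, hm₂, hm₃⟩ := h
  exact ⟨h0, hs, fun a => (hm₁ a).trans (h₁ a), fun b => (hm₂ b).trans (h₂ b),
    fun c => (hm₃ c).trans (h₃ c)⟩

/-- Swap the first two coordinates. [folklore] -/
theorem cpl_swap12 {m : ℕ} {f₁ f₂ f₃ : ℕ → ℝ} {w : ℕ → ℕ → ℕ → ℝ} (h : Cpl[m, f₁, f₂, f₃, w]) :
    Cpl[m, f₂, f₁, f₃, fun a b c => w b a c] := by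
  obtain ⟨h0, hs, h1, h2, h3⟩ := h
  refine ⟨fun a b c => h0 b a c, fun a b c habc => hs b a c (by omega), fun a => h2 a, fun b => h1 b,
    fun c => ?_⟩
  rw [Finset.sum_comm]; exact h3 c

/-- Swap the last two coordinates. [folklore] -/
theorem cpl_swap23 {m : ℕ} {f₁ f₂ f₃ : ℕ → ℝ} {w : ℕ → ℕ → ℕ → ℝ} (h : Cpl[m, f₁, f₂, f₃, w]) :
    Cpl[m, f₁, f₃, f₂, fun a b c => w a c b] := by
  obtain ⟨h0, hs, h1, h2, h3⟩ := h
  refine ⟨fun a b c => h0 a c b, fun a b c habc => hs a c b (by omega), fun a => ?_, fun b => h3 b,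
    fun c => h2 c⟩
  rw [Finset.sum_comm]; exact h1 a

/-- Swap the first and the last coordinates. [folklore] -/
theorem cpl_swap13 {m : ℕ} {f₁ f₂ f₃ : ℕ → ℝ} {w : ℕ → ℕ → ℕ → ℝ} (h : Cpl[m, f₁, f₂, f₃, w]) :
    Cpl[m, f₃, f₂, f₁, fun a b c => w c b a] :=
  cpl_swap23 (cpl_swap12 (cpl_swap23 h))

/-- Nonnegative linear combinations of couplings. [folklore] -/
theorem cpl_add {m : ℕ} {f₁ f₂ f₃ g₁ g₂ g₃ : ℕ → ℝ} {w v : ℕ → ℕ → ℕ → ℝ} {s t : ℝ}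
    (hw : Cpl[m, f₁, f₂, f₃, w]) (hv : Cpl[m, g₁, g₂, g₃, v]) (hs : 0 ≤ s) (ht : 0 ≤ t) :
    Cpl[m, fun k => s * f₁ k + t * g₁ k, fun k => s * f₂ k + t * g₂ k,
      fun k => s * f₃ k + t * g₃ k, fun a b c => s * w a b c + t * v a b c] := by
  obtain ⟨hw0, hws, hw1, hw2, hw3⟩ := hw
  obtain ⟨hv0, hvs, hv1, hv2, hv3⟩ := hv
  beta_reduce
  refine ⟨fun a b c => add_nonneg (mul_nonneg hs (hw0 a b c)) (mul_nonneg ht (hv0 a b c)),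
    fun a b c habc => by rw [hws a b c habc, hvs a b c habc]; ring, fun a => ?_, fun b => ?_,
    fun c => ?_⟩
  · simp only [Finset.sum_add_distrib, ← Finset.mul_sum, hw1 a, hv1 a]
  · simp only [Finset.sum_add_distrib, ← Finset.mul_sum, hw2 b, hv2 b]
  · simp only [Finset.sum_add_distrib, ← Finset.mul_sum, hw3 c, hv3 c]

/-- Scaling a coupling by `t ≥ 0`. [folklore] -/
theorem cpl_smul {m : ℕ} {f₁ f₂ f₃ : ℕ → ℝ} {w : ℕ → ℕ → ℕ → ℝ} {t : ℝ}
    (hw : Cpl[m, f₁, f₂, f₃, w]) (ht : 0 ≤ t) :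
    Cpl[m, fun k => t * f₁ k, fun k => t * f₂ k, fun k => t * f₃ k, fun a b c => t * w a b c] := by
  have h := cpl_add hw hw ht le_rfl
  beta_reduce at h
  simp only [zero_mul, add_zero] at h
  beta_reduce
  exact h

/-- Finite sums of couplings. [folklore] -/
theorem cpl_sum {ι : Type*} (s : Finset ι) {m : ℕ} {f₁ f₂ f₃ : ι → ℕ → ℝ}
    {w : ι → ℕ → ℕ → ℕ → ℝ} (h : ∀ i ∈ s, Cpl[m, f₁ i, f₂ i, f₃ i, w i]) :
    Cpl[m, fun k => ∑ i ∈ s, f₁ i k, fun k => ∑ i ∈ s, f₂ i k, fun k => ∑ i ∈ s, f₃ i k,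
      fun a b c => ∑ i ∈ s, w i a b c] := by
  beta_reduce
  refine ⟨fun a b c => Finset.sum_nonneg fun i hi => (h i hi).1 a b c,
    fun a b c habc => Finset.sum_eq_zero fun i hi => (h i hi).2.1 a b c habc, fun a => ?_,
    fun b => ?_, fun c => ?_⟩
  · refine (Finset.sum_congr rfl fun i hi => ((h i hi).2.2.1 a).symm).trans ?_ |>.symm
    rw [Finset.sum_comm]
    exact Finset.sum_congr rfl fun b _ => Finset.sum_comm
  · refine (Finset.sum_congr rfl fun i hi => ((h i hi).2.2.2.1 b).symm).trans ?_ |>.symm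
    rw [Finset.sum_comm]
    exact Finset.sum_congr rfl fun b _ => Finset.sum_comm
  · refine (Finset.sum_congr rfl fun i hi => ((h i hi).2.2.2.2 c).symm).trans ?_ |>.symm
    rw [Finset.sum_comm]
    exact Finset.sum_congr rfl fun b _ => Finset.sum_comm

/-- The zero coupling. [folklore] -/
theorem cpl_zero (m : ℕ) :
    Cpl[m, fun _ => (0:ℝ), fun _ => (0:ℝ), fun _ => (0:ℝ), fun _ _ _ => (0:ℝ)] := by
  beta_reduce
  exact ⟨fun _ _ _ => le_rfl, fun _ _ _ _ => rfl, fun _ => by simp, fun _ => by simp, fun _ => by simp⟩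

/-- The point coupling: mass `t ≥ 0` at a single triple `(a₀, b₀, c₀)` with `a₀ + b₀ + c₀ = m`.
[folklore] -/
theorem cpl_point {m a₀ b₀ c₀ : ℕ} (h : a₀ + b₀ + c₀ = m) {t : ℝ} (ht : 0 ≤ t) :
    Cpl[m, fun k => if k = a₀ then t else 0, fun k => if k = b₀ then t else 0,
      fun k => if k = c₀ then t else 0,
      fun a b c => (if a = a₀ then (1:ℝ) else 0) * (if b = b₀ then (1:ℝ) else 0) *
        (if c = c₀ then t else 0)] := by
  beta_reduce
  have ha₀ : a₀ ∈ Finset.range (m + 1) := Finset.mem_range.2 (by omega)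
  have hb₀ : b₀ ∈ Finset.range (m + 1) := Finset.mem_range.2 (by omega)
  have hc₀ : c₀ ∈ Finset.range (m + 1) := Finset.mem_range.2 (by omega)
  refine ⟨fun a b c => ?_, fun a b c habc => ?_, fun a => ?_, fun b => ?_, fun c => ?_⟩
  · split_ifs <;> positivity
  · have : ¬ (a = a₀ ∧ b = b₀ ∧ c = c₀) := fun hh => habc (by rw [hh.1, hh.2.1, hh.2.2]; exact h)
    split_ifs with h1 h2 h3 <;> simp_all
  · simp_rw [mul_assoc, ← Finset.mul_sum, ← Finset.sum_mul, Finset.sum_ite_eq' _ b₀,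
      Finset.sum_ite_eq' _ c₀, if_pos hb₀, if_pos hc₀]
    split_ifs <;> simp
  · simp_rw [mul_assoc, ← Finset.mul_sum, Finset.sum_ite_eq' _ c₀, if_pos hc₀, ← Finset.sum_mul,
      Finset.sum_ite_eq' _ a₀, if_pos ha₀]
    split_ifs <;> ring
  · simp_rw [← Finset.sum_mul, ← Finset.mul_sum, Finset.sum_ite_eq' _ b₀, if_pos hb₀, mul_one,
      Finset.sum_ite_eq' _ a₀, if_pos ha₀, one_mul]

/-- Enlarging the summation box does not change a double sum whose summand vanishes outside
`[0, m]²`. [folklore] -/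
theorem sum_sum_range_eq_of_vanish {m N₁ N₂ : ℕ} (g : ℕ → ℕ → ℝ)
    (hb : ∀ b c, m < b → g b c = 0) (hc : ∀ b c, m < c → g b c = 0) (h₁ : m + 1 ≤ N₁)
    (h₂ : m + 1 ≤ N₂) :
    ∑ b ∈ Finset.range N₁, ∑ c ∈ Finset.range N₂, g b c =
      ∑ b ∈ Finset.range (m + 1), ∑ c ∈ Finset.range (m + 1), g b c := by
  have inner : ∀ b, ∑ c ∈ Finset.range N₂, g b c = ∑ c ∈ Finset.range (m + 1), g b c := by
    intro b
    refine (Finset.sum_subset (Finset.range_subset_range.2 h₂) fun c hc' hcm => ?_).symm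
    simp only [Finset.mem_range, not_lt] at hc' hcm
    exact hc b c (by omega)
  simp_rw [inner]
  refine (Finset.sum_subset (Finset.range_subset_range.2 h₁) fun b hb' hbm => ?_).symm
  simp only [Finset.mem_range, not_lt] at hb' hbm
  exact Finset.sum_eq_zero fun c _ => hb b c (by omega)

/-- The first marginal of a coupling, summed over any box containing `[0, m]²`. [folklore] -/
theorem cpl_marg₁ {m : ℕ} {f₁ f₂ f₃ : ℕ → ℝ} {w : ℕ → ℕ → ℕ → ℝ} (h : Cpl[m, f₁, f₂, f₃, w])
    {N₁ N₂ : ℕ} (h₁ : m + 1 ≤ N₁) (h₂ : m + 1 ≤ N₂) (a : ℕ) :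
    ∑ b ∈ Finset.range N₁, ∑ c ∈ Finset.range N₂, w a b c = f₁ a := by
  rw [sum_sum_range_eq_of_vanish (fun b c => w a b c) (fun b c hb => h.2.1 a b c (by omega))
    (fun b c hc => h.2.1 a b c (by omega)) h₁ h₂]
  exact h.2.2.1 a

/-- The second marginal of a coupling, summed over any box containing `[0, m]²`. [folklore] -/
theorem cpl_marg₂ {m : ℕ} {f₁ f₂ f₃ : ℕ → ℝ} {w : ℕ → ℕ → ℕ → ℝ} (h : Cpl[m, f₁, f₂, f₃, w])
    {N₁ N₂ : ℕ} (h₁ : m + 1 ≤ N₁) (h₂ : m + 1 ≤ N₂) (b : ℕ) :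
    ∑ a ∈ Finset.range N₁, ∑ c ∈ Finset.range N₂, w a b c = f₂ b := by
  rw [sum_sum_range_eq_of_vanish (fun a c => w a b c) (fun a c ha => h.2.1 a b c (by omega))
    (fun a c hc => h.2.1 a b c (by omega)) h₁ h₂]
  exact h.2.2.2.1 b

/-- The third marginal of a coupling, summed over any box containing `[0, m]²`. [folklore] -/
theorem cpl_marg₃ {m : ℕ} {f₁ f₂ f₃ : ℕ → ℝ} {w : ℕ → ℕ → ℕ → ℝ} (h : Cpl[m, f₁, f₂, f₃, w])
    {N₁ N₂ : ℕ} (h₁ : m + 1 ≤ N₁) (h₂ : m + 1 ≤ N₂) (c : ℕ) :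
    ∑ a ∈ Finset.range N₁, ∑ b ∈ Finset.range N₂, w a b c = f₃ c := by
  rw [sum_sum_range_eq_of_vanish (fun a b => w a b c) (fun a b ha => h.2.1 a b c (by omega))
    (fun a b hb => h.2.1 a b c (by omega)) h₁ h₂]
  exact h.2.2.2.2 c

/-- A marginal of a coupling vanishes above `m`. [folklore] -/
theorem cpl_f₁_eq_zero {m : ℕ} {f₁ f₂ f₃ : ℕ → ℝ} {w : ℕ → ℕ → ℕ → ℝ} (h : Cpl[m, f₁, f₂, f₃, w])
    {a : ℕ} (ha : m < a) : f₁ a = 0 := by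
  rw [← h.2.2.1 a]
  exact Finset.sum_eq_zero fun b _ => Finset.sum_eq_zero fun c _ => h.2.1 a b c (by omega)

/-- A marginal of a coupling is nonnegative. [folklore] -/
theorem cpl_f₁_nonneg {m : ℕ} {f₁ f₂ f₃ : ℕ → ℝ} {w : ℕ → ℕ → ℕ → ℝ} (h : Cpl[m, f₁, f₂, f₃, w])
    (a : ℕ) : 0 ≤ f₁ a := by
  rw [← h.2.2.1 a]
  exact Finset.sum_nonneg fun b _ => Finset.sum_nonneg fun c _ => h.1 a b c

/-- Shifting the first coordinate of a coupling up by `d` (level `m ↦ m + d`). [folklore] -/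
theorem cpl_shift1 {m : ℕ} {f₁ f₂ f₃ : ℕ → ℝ} {w : ℕ → ℕ → ℕ → ℝ} (h : Cpl[m, f₁, f₂, f₃, w])
    (d : ℕ) :
    Cpl[m + d, fun k => if d ≤ k then f₁ (k - d) else 0, f₂, f₃,
      fun a b c => if d ≤ a then w (a - d) b c else 0] := by
  beta_reduce
  refine ⟨fun a b c => ?_, fun a b c habc => ?_, fun a => ?_, fun b => ?_, fun c => ?_⟩
  · split_ifs
    · exact h.1 _ _ _
    · exact le_rfl
  · split_ifs with hda
    · exact h.2.1 _ _ _ (by omega)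
    · rfl
  · split_ifs with hda
    · exact cpl_marg₁ h (by omega) (by omega) (a - d)
    · simp
  · rw [show m + d + 1 = d + (m + 1) by omega, Finset.sum_range_add]
    rw [Finset.sum_eq_zero fun a ha => ?_, zero_add]
    · simp_rw [if_pos (Nat.le_add_right d _), Nat.add_sub_cancel_left]
      exact cpl_marg₂ h le_rfl (by omega) b
    · simp only [Finset.mem_range] at ha
      simp [Nat.not_le.2 ha]
  · rw [show m + d + 1 = d + (m + 1) by omega, Finset.sum_range_add]
    rw [Finset.sum_eq_zero fun a ha => ?_, zero_add]
    · simp_rw [if_pos (Nat.le_add_right d _), Nat.add_sub_cancel_left]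
      exact cpl_marg₃ h le_rfl (by omega) c
    · simp only [Finset.mem_range] at ha
      simp [Nat.not_le.2 ha]

/-- Shifting the second coordinate of a coupling up by `d`. [folklore] -/
theorem cpl_shift2 {m : ℕ} {f₁ f₂ f₃ : ℕ → ℝ} {w : ℕ → ℕ → ℕ → ℝ} (h : Cpl[m, f₁, f₂, f₃, w])
    (d : ℕ) :
    Cpl[m + d, f₁, fun k => if d ≤ k then f₂ (k - d) else 0, f₃,
      fun a b c => if d ≤ b then w a (b - d) c else 0] :=
  cpl_swap12 (cpl_shift1 (cpl_swap12 h) d)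

/-- Shifting the third coordinate of a coupling up by `d`. [folklore] -/
theorem cpl_shift3 {m : ℕ} {f₁ f₂ f₃ : ℕ → ℝ} {w : ℕ → ℕ → ℕ → ℝ} (h : Cpl[m, f₁, f₂, f₃, w])
    (d : ℕ) :
    Cpl[m + d, f₁, f₂, fun k => if d ≤ k then f₃ (k - d) else 0,
      fun a b c => if d ≤ c then w a b (c - d) else 0] :=
  cpl_swap13 (cpl_shift1 (cpl_swap13 h) d)

set_option quotPrecheck false in
/-- Uniform probability vector on `[0, k]`: `𝑈 k j = [j ≤ k] / (k + 1)`. -/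
local notation "𝑈" => (fun (k j : ℕ) => if j ≤ k then ((k : ℝ) + 1)⁻¹ else (0 : ℝ))

/-- Pebody's Lemma 9, case `a = 0`: `X = 0`, `Y` uniform on `[0, b]`, `Z = b − Y`.
[cite: Peabody2018, Lemma 9] -/
theorem lemma9_zero (b : ℕ) : ∃ w : ℕ → ℕ → ℕ → ℝ, Cpl[b, 𝑈 0, 𝑈 b, 𝑈 b, w] := by
  have hb : (0:ℝ) < (b:ℝ) + 1 := by positivity
  have h := cpl_sum (Finset.range (b + 1)) (m := b)
    (f₁ := fun y k => if k = 0 then ((b:ℝ) + 1)⁻¹ else 0)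
    (f₂ := fun y k => if k = y then ((b:ℝ) + 1)⁻¹ else 0)
    (f₃ := fun y k => if k = b - y then ((b:ℝ) + 1)⁻¹ else 0)
    (w := fun y a b' c => (if a = 0 then (1:ℝ) else 0) * (if b' = y then (1:ℝ) else 0) *
        (if c = b - y then ((b:ℝ) + 1)⁻¹ else 0))
    (fun y hy => cpl_point (by simp only [Finset.mem_range] at hy; omega) (by positivity))
  refine ⟨_, cpl_congr h (fun k => ?_) (fun k => ?_) (fun k => ?_)⟩
  · simp only [Finset.sum_const, Finset.card_range, nsmul_eq_mul, Nat.le_zero]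
    split_ifs
    · rw [Nat.cast_add_one, mul_inv_cancel₀ hb.ne']; norm_num
    · simp
  · beta_reduce
    rw [Finset.sum_ite_eq]
    simp [Finset.mem_range]
  · beta_reduce
    rw [Finset.sum_flip (n := b) (fun y => if k = y then ((b:ℝ) + 1)⁻¹ else 0), Finset.sum_ite_eq]
    simp [Finset.mem_range]

/-- Arithmetic of the first marginal in the recursion for Lemma 9. [folklore] -/
theorem lemma9_id₁ (a' b' k : ℕ) :
    (1:ℝ) * (if k = 0 then ((a':ℝ) + 1 + (b' + 1) + 1)⁻¹ else 0) +
      1 * (((a':ℝ) + 1) * ((a':ℝ) + 1 + (b' + 1) + 1)⁻¹ *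
          (if 1 ≤ k then (if k - 1 ≤ a' then ((a':ℝ) + 1)⁻¹ else 0) else 0) +
        ((b':ℝ) + 1) * ((a':ℝ) + 1 + (b' + 1) + 1)⁻¹ *
          (if k ≤ a' + 1 then (((a' + 1 : ℕ) : ℝ) + 1)⁻¹ else 0)) =
      (if k ≤ a' + 1 then (((a' + 1 : ℕ) : ℝ) + 1)⁻¹ else 0) := by
  have h1 : (0:ℝ) < (a':ℝ) + 1 := by positivity
  have h2 : (0:ℝ) < (a':ℝ) + 1 + (b' + 1) + 1 := by positivity
  have h3 : (0:ℝ) < (a':ℝ) + 1 + 1 := by positivity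
  push_cast
  rcases Nat.eq_zero_or_pos k with rfl | hk
  · simp only [if_true, Nat.le_zero, one_ne_zero, if_false, zero_le]
    field_simp
    ring
  · have hk1 : 1 ≤ k := hk
    have hk0 : k ≠ 0 := by omega
    simp only [hk0, if_false, hk1, if_true]
    by_cases hka : k ≤ a' + 1
    · have : k - 1 ≤ a' := by omega
      simp only [this, if_true, hka]
      field_simp
      ring
    · have : ¬ (k - 1 ≤ a') := by omega
      simp only [this, if_false, hka]
      ring

/-- Arithmetic of the third marginal in the recursion for Lemma 9. [folklore] -/
theorem lemma9_id₃ (a' b' k : ℕ) :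
    (1:ℝ) * (if k = a' + 1 + (b' + 1) then ((a':ℝ) + 1 + (b' + 1) + 1)⁻¹ else 0) +
      1 * (((a':ℝ) + 1) * ((a':ℝ) + 1 + (b' + 1) + 1)⁻¹ *
          (if k ≤ a' + (b' + 1) then (((a' + (b' + 1) : ℕ) : ℝ) + 1)⁻¹ else 0) +
        ((b':ℝ) + 1) * ((a':ℝ) + 1 + (b' + 1) + 1)⁻¹ *
          (if k ≤ a' + 1 + b' then (((a' + 1 + b' : ℕ) : ℝ) + 1)⁻¹ else 0)) =
      (if k ≤ a' + 1 + (b' + 1) then (((a' + 1 + (b' + 1) : ℕ) : ℝ) + 1)⁻¹ else 0) := by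
  have h2 : (0:ℝ) < (a':ℝ) + 1 + (b' + 1) + 1 := by positivity
  have h3 : (0:ℝ) < (a':ℝ) + (b' + 1) + 1 := by positivity
  push_cast
  rcases lt_trichotomy k (a' + 1 + (b' + 1)) with hk | rfl | hk
  · have e1 : k ≤ a' + (b' + 1) := by omega
    have e2 : k ≤ a' + 1 + b' := by omega
    have e3 : k ≠ a' + 1 + (b' + 1) := by omega
    have e4 : k ≤ a' + 1 + (b' + 1) := by omega
    simp only [e1, e2, e3, e4, if_true, if_false]
    field_simp
    ring
  · have e1 : ¬ (a' + 1 + (b' + 1) ≤ a' + (b' + 1)) := by omega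
    have e2 : ¬ (a' + 1 + (b' + 1) ≤ a' + 1 + b') := by omega
    simp only [e1, e2, if_true, if_false, le_refl]
    ring
  · have e1 : ¬ (k ≤ a' + (b' + 1)) := by omega
    have e2 : ¬ (k ≤ a' + 1 + b') := by omega
    have e3 : k ≠ a' + 1 + (b' + 1) := by omega
    have e4 : ¬ (k ≤ a' + 1 + (b' + 1)) := by omega
    simp only [e1, e2, e3, e4, if_false]
    ring

/-- **Pebody's Lemma 9** ("for any non-negative integers `m` and `n` one can pair distributions
`X` and `Y` that are uniform on `{0, …, m}` and `{0, …, n}` such that `X + Y` is uniform on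
`{0, …, m + n}`"), as a coupling at level `a + b` (third coordinate `a + b − X − Y`). The printed
proof uses continuous i.i.d. variables; here the coupling is built by the recursion
`C(a,b) = (δ_{(0,0)} + a·(1,0)+C(a−1,b) + b·(0,1)+C(a,b−1)) / (a+b+1)`.
[cite: Peabody2018, Lemma 9] -/
theorem lemma9 (n : ℕ) :
    ∀ a b : ℕ, a + b = n → ∃ w : ℕ → ℕ → ℕ → ℝ, Cpl[a + b, 𝑈 a, 𝑈 b, 𝑈 (a + b), w] := by
  induction n with
  | zero =>
    intro a b hab
    obtain ⟨rfl, rfl⟩ : a = 0 ∧ b = 0 := by omega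
    simpa using lemma9_zero 0
  | succ n ih =>
    intro a b hab
    rcases a with _ | a'
    · simpa using lemma9_zero b
    rcases b with _ | b'
    · obtain ⟨w, hw⟩ := lemma9_zero (a' + 1)
      exact ⟨_, by simpa using cpl_swap12 hw⟩
    obtain ⟨w₁, hw₁⟩ := ih a' (b' + 1) (by omega)
    obtain ⟨w₂, hw₂⟩ := ih (a' + 1) b' (by omega)
    have h₁ := cpl_shift1 hw₁ 1
    have h₂ := cpl_shift2 hw₂ 1
    have hp := cpl_point (m := a' + 1 + (b' + 1)) (a₀ := 0) (b₀ := 0) (c₀ := a' + 1 + (b' + 1))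
      (by omega) (t := ((a':ℝ) + 1 + (b' + 1) + 1)⁻¹) (by positivity)
    rw [show a' + (b' + 1) + 1 = a' + 1 + (b' + 1) by omega] at h₁
    rw [show a' + 1 + b' + 1 = a' + 1 + (b' + 1) by omega] at h₂
    have h₁₂ := cpl_add h₁ h₂ (s := ((a':ℝ) + 1) * ((a':ℝ) + 1 + (b' + 1) + 1)⁻¹)
      (t := ((b':ℝ) + 1) * ((a':ℝ) + 1 + (b' + 1) + 1)⁻¹) (by positivity) (by positivity)
    have h := cpl_add hp h₁₂ zero_le_one zero_le_one
    refine ⟨_, cpl_congr h (fun k => ?_) (fun k => ?_) (fun k => ?_)⟩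
    · exact lemma9_id₁ a' b' k
    · have h2 := lemma9_id₁ b' a' k
      have hC : (b':ℝ) + 1 + (a' + 1) + 1 = a' + 1 + (b' + 1) + 1 := by ring
      rw [hC] at h2
      beta_reduce
      linarith [h2]
    · exact lemma9_id₃ a' b' k

/-- The coupling `(U_m, U_m, δ₀)`: `X` uniform on `[0, m]`, `Y = m − X`, `Z = 0` (Pebody, §5:
"let `X₁ = 0`, `X₂` be uniform on `[p]` and let `X₃ = (p − 1) − X₂`"). [cite: Peabody2018, §5] -/
theorem cpl_uniform_uniform_zero (m : ℕ) : ∃ w : ℕ → ℕ → ℕ → ℝ, Cpl[m, 𝑈 m, 𝑈 m, 𝑈 0, w] := by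
  obtain ⟨w, hw⟩ := lemma9 m m 0 rfl
  have h := cpl_swap23 hw
  simp only [add_zero] at h
  exact ⟨_, h⟩

/-- Arithmetic of the first marginal in Corollary 10. [folklore] -/
theorem cor10_id₁ (i j r k : ℕ) :
    (((i:ℝ) + j + 1) * ((i:ℝ) + j + r + 2)⁻¹ * (if k ≤ i then ((i:ℝ) + 1)⁻¹ else 0) +
      ((r:ℝ) + 1) * ((i:ℝ) + j + r + 2)⁻¹ * (if k ≤ i then ((i:ℝ) + 1)⁻¹ else 0)) =
    if k ≤ i then ((i:ℝ) + 1)⁻¹ else 0 := by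
  have h : (0:ℝ) < (i:ℝ) + j + r + 2 := by positivity
  split_ifs
  · field_simp; ring
  · ring

/-- Arithmetic of the second marginal in Corollary 10. [folklore] -/
theorem cor10_id₂ (i j r k : ℕ) :
    (((i:ℝ) + j + 1) * ((i:ℝ) + j + r + 2)⁻¹ *
        (if r + 1 ≤ k then (if k - (r + 1) ≤ i + j then (((i + j : ℕ) : ℝ) + 1)⁻¹ else 0) else 0) +
      ((r:ℝ) + 1) * ((i:ℝ) + j + r + 2)⁻¹ * (if k ≤ r then ((r:ℝ) + 1)⁻¹ else 0)) =
    if k ≤ i + j + 1 + r then (((i + j + 1 + r : ℕ) : ℝ) + 1)⁻¹ else 0 := by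
  have h : (0:ℝ) < (i:ℝ) + j + r + 2 := by positivity
  have h2 : (0:ℝ) < (i:ℝ) + j + 1 := by positivity
  have h3 : (0:ℝ) < (r:ℝ) + 1 := by positivity
  push_cast
  by_cases hk : k ≤ r
  · have e1 : ¬ (r + 1 ≤ k) := by omega
    have e2 : k ≤ i + j + 1 + r := by omega
    simp only [hk, e1, e2, if_true, if_false]
    field_simp; ring
  · by_cases hk2 : k ≤ i + j + 1 + r
    · have e1 : r + 1 ≤ k := by omega
      have e2 : k - (r + 1) ≤ i + j := by omega
      simp only [hk, e1, e2, hk2, if_true, if_false]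
      field_simp; ring
    · have e1 : r + 1 ≤ k := by omega
      have e2 : ¬ (k - (r + 1) ≤ i + j) := by omega
      simp only [hk, e1, e2, hk2, if_true, if_false]
      ring

/-- Arithmetic of the third marginal in Corollary 10. [folklore] -/
theorem cor10_id₃ (i j r k : ℕ) :
    (((i:ℝ) + j + 1) * ((i:ℝ) + j + r + 2)⁻¹ * (if k ≤ j then ((j:ℝ) + 1)⁻¹ else 0) +
      ((r:ℝ) + 1) * ((i:ℝ) + j + r + 2)⁻¹ *
        (if j + 1 ≤ k then (if k - (j + 1) ≤ i + r then (((i + r : ℕ) : ℝ) + 1)⁻¹ else 0) else 0)) =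
    (i:ℝ) / ((i:ℝ) + r + 1) * (if k ≤ j then ((j:ℝ) + 1)⁻¹ else 0) +
      (1 - (i:ℝ) / ((i:ℝ) + r + 1)) *
        (if k ≤ i + j + 1 + r then (((i + j + 1 + r : ℕ) : ℝ) + 1)⁻¹ else 0) := by
  have h : (0:ℝ) < (i:ℝ) + j + r + 2 := by positivity
  have h2 : (0:ℝ) < (i:ℝ) + r + 1 := by positivity
  have h3 : (0:ℝ) < (j:ℝ) + 1 := by positivity
  push_cast
  by_cases hk : k ≤ j
  · have e1 : ¬ (j + 1 ≤ k) := by omega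
    have e2 : k ≤ i + j + 1 + r := by omega
    simp only [hk, e1, e2, if_true, if_false]
    field_simp; ring
  · by_cases hk2 : k ≤ i + j + 1 + r
    · have e1 : j + 1 ≤ k := by omega
      have e2 : k - (j + 1) ≤ i + r := by omega
      simp only [hk, e1, e2, hk2, if_true, if_false]
      field_simp; ring
    · have e1 : j + 1 ≤ k := by omega
      have e2 : ¬ (k - (j + 1) ≤ i + r) := by omega
      simp only [hk, e1, e2, hk2, if_true, if_false]
      ring

/-- **Pebody's Corollary 10** (the remaining case): for `m = i + j + 1 + r` the distributions
`U_i`, `U_m` and `V = (i/(i+r+1)) U_j + (1 − i/(i+r+1)) U_m` (the printed `V_{j,p−1,p−1−i}`) are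
compatible: with probability `(i+j+1)/(m+1)` take `(X, m − X − Y, Y)` with `(X, Y)` a Lemma-9 coupling
of `U_i, U_j`, otherwise `(X', Y', m − X' − Y')` with `(X', Y')` a Lemma-9 coupling of `U_i, U_r`.
[cite: Peabody2018, Corollary 10] -/
theorem cor10 (i j r : ℕ) : ∃ w : ℕ → ℕ → ℕ → ℝ,
    Cpl[i + j + 1 + r, 𝑈 i, 𝑈 (i + j + 1 + r),
      fun k => (i:ℝ) / ((i:ℝ) + r + 1) * 𝑈 j k + (1 - (i:ℝ) / ((i:ℝ) + r + 1)) * 𝑈 (i + j + 1 + r) k,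
      w] := by
  obtain ⟨w₁, hw₁⟩ := lemma9 (i + j) i j rfl
  obtain ⟨w₂, hw₂⟩ := lemma9 (i + r) i r rfl
  have hH := cpl_shift2 (cpl_swap23 hw₁) (r + 1)
  have hT := cpl_shift3 hw₂ (j + 1)
  rw [show i + j + (r + 1) = i + j + 1 + r by omega] at hH
  rw [show i + r + (j + 1) = i + j + 1 + r by omega] at hT
  have h := cpl_add hH hT (s := ((i:ℝ) + j + 1) * ((i:ℝ) + j + r + 2)⁻¹)
    (t := ((r:ℝ) + 1) * ((i:ℝ) + j + r + 2)⁻¹) (by positivity) (by positivity)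
  refine ⟨_, cpl_congr h (fun k => ?_) (fun k => ?_) (fun k => ?_)⟩
  · beta_reduce
    exact cor10_id₁ i j r k
  · beta_reduce
    exact cor10_id₂ i j r k
  · beta_reduce
    exact cor10_id₃ i j r k

/-! ### Lemma 7 and Corollary 8 (the induction step) -/

/-- An antitone function vanishing above `n` is nonnegative. [folklore] -/
theorem nonneg_of_antitone_of_vanish {f : ℕ → ℝ} (hf : Antitone f) {n : ℕ}
    (hn : ∀ k, n < k → f k = 0) (k : ℕ) : 0 ≤ f k := by
  have h := hf (show k ≤ k + n + 1 by omega)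
  rwa [hn (k + n + 1) (by omega)] at h

/-- The residual of the greedy allocation stays decreasing (Pebody, proof of Cor. 8: "Thus `g₂` is
non-increasing"): if `u` is antitone and `v` is monotone then `k ↦ u k − min (u k, v k, x)` is
antitone. [cite: Peabody2018, Corollary 8 (proof)] -/
theorem antitone_sub_min {u v : ℕ → ℝ} (hu : Antitone u) (hv : Monotone v) (x : ℝ) :
    Antitone fun k => u k - min (u k) (min (v k) x) := by
  refine antitone_nat_of_succ_le fun k => ?_
  set g : ℕ → ℝ := fun k => min (u k) (min (v k) x) with hg
  show u (k + 1) - g (k + 1) ≤ u k - g k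
  rcases le_or_gt (g k) (g (k + 1)) with hle | hlt
  · linarith [hu (Nat.le_succ k)]
  · -- `g (k+1) < g k ≤ min (v k) x ≤ min (v (k+1)) x`, so the minimum at `k+1` is `u (k+1)`.
    have h1 : g k ≤ min (v k) x := min_le_right _ _
    have h2 : min (v k) x ≤ min (v (k + 1)) x := min_le_min_right _ (hv (Nat.le_succ k))
    have hlt' : g (k + 1) < min (v (k + 1)) x := lt_of_lt_of_le hlt (h1.trans h2)
    have h3 : g (k + 1) = u (k + 1) := by
      have : u (k + 1) < min (v (k + 1)) x := by
        rcases min_lt_iff.1 hlt' with h | h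
        · exact h
        · exact absurd h (lt_irrefl _)
      exact min_eq_left this.le
    have h4 : g k ≤ u k := min_le_left _ _
    rw [h3]; linarith

/-- The pairing inequality behind Lemma 7: for a decreasing `f`, `Σ_{k ≤ t} (2k − t) f(k) ≤ 0`
(the mean of a decreasing distribution on `[0, t]` is at most `t/2`).
[cite: Peabody2018, Lemma 7 (proof)] -/
theorem sum_two_mul_sub_mul_nonpos {f : ℕ → ℝ} (hf : Antitone f) (t : ℕ) :
    ∑ k ∈ Finset.range (t + 1), (2 * (k:ℝ) - t) * f k ≤ 0 := by
  set S := ∑ k ∈ Finset.range (t + 1), (2 * (k:ℝ) - t) * f k with hS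
  have hrefl := Finset.sum_flip (n := t) (fun k => (2 * (k:ℝ) - t) * f k)
  have h2 : 2 * S = ∑ k ∈ Finset.range (t + 1), (2 * (k:ℝ) - t) * (f k - f (t - k)) := by
    rw [two_mul]
    nth_rewrite 2 [hS]
    rw [← hrefl, ← Finset.sum_add_distrib]
    refine Finset.sum_congr rfl fun k hk => ?_
    simp only [Finset.mem_range] at hk
    rw [Nat.cast_sub (by omega : k ≤ t)]
    ring
  have h3 : ∑ k ∈ Finset.range (t + 1), (2 * (k:ℝ) - t) * (f k - f (t - k)) ≤ 0 := by
    refine Finset.sum_nonpos fun k hk => ?_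
    rcases le_or_gt (t - k) k with hk' | hk'
    · exact mul_nonpos_of_nonneg_of_nonpos (by
        have : ((t - k : ℕ) : ℝ) ≤ k := by exact_mod_cast hk'
        rw [Nat.cast_sub (by simp only [Finset.mem_range] at hk; omega)] at this; linarith)
        (sub_nonpos.2 (hf hk'))
    · exact mul_nonpos_of_nonpos_of_nonneg (by
        have : (k : ℝ) + 1 ≤ ((t - k : ℕ) : ℝ) := by exact_mod_cast hk'
        rw [Nat.cast_sub (by simp only [Finset.mem_range] at hk; omega)] at this; linarith)
        (sub_nonneg.2 (hf hk'.le))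
  linarith

/-- **Pebody's Lemma 7**, the one-distribution estimate ("the expected value of `π` is at most
`t/2 + (p/2) P(π > t)`"), unnormalised: for a decreasing `f` on `[0, L]` and `t ≤ L`,
`2 Σ_{k≤L} k f(k) ≤ t Σ_{k≤L} f(k) + (L+1) Σ_{t<k≤L} f(k)`. [cite: Peabody2018, Lemma 7] -/
theorem lemma7_bound {f : ℕ → ℝ} (hf : Antitone f) {L t : ℕ} (ht : t ≤ L) :
    2 * ∑ k ∈ Finset.range (L + 1), (k:ℝ) * f k ≤
      t * ∑ k ∈ Finset.range (L + 1), f k +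
        ((L:ℝ) + 1) * (∑ k ∈ Finset.range (L + 1), f k - ∑ k ∈ Finset.range (t + 1), f k) := by
  have hsplit := Finset.sum_range_add_sum_Ico f (show t + 1 ≤ L + 1 by omega)
  have hsplitM := Finset.sum_range_add_sum_Ico (fun k => (k:ℝ) * f k) (show t + 1 ≤ L + 1 by omega)
  -- head: `2 Σ_{k≤t} k f k ≤ t Σ_{k≤t} f k`
  have hA : 2 * ∑ k ∈ Finset.range (t + 1), (k:ℝ) * f k ≤ t * ∑ k ∈ Finset.range (t + 1), f k := by
    have h := sum_two_mul_sub_mul_nonpos hf t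
    have : ∑ k ∈ Finset.range (t + 1), (2 * (k:ℝ) - t) * f k =
        2 * ∑ k ∈ Finset.range (t + 1), (k:ℝ) * f k - t * ∑ k ∈ Finset.range (t + 1), f k := by
      rw [Finset.mul_sum, Finset.mul_sum, ← Finset.sum_sub_distrib]
      exact Finset.sum_congr rfl fun k _ => by ring
    linarith
  -- tail: `2 Σ_{t<k≤L} k f k ≤ (L+t+1) Σ_{t<k≤L} f k`
  have hB : 2 * ∑ k ∈ Finset.Ico (t + 1) (L + 1), (k:ℝ) * f k ≤
      ((L:ℝ) + t + 1) * ∑ k ∈ Finset.Ico (t + 1) (L + 1), f k := by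
    rcases Nat.eq_or_lt_of_le ht with rfl | htL
    · simp
    · rw [Finset.sum_Ico_eq_sum_range, Finset.sum_Ico_eq_sum_range,
        show L + 1 - (t + 1) = (L - t - 1) + 1 by omega]
      have h := sum_two_mul_sub_mul_nonpos (f := fun j => f (t + 1 + j))
        (fun a b hab => hf (by omega)) (L - t - 1)
      have : ∑ k ∈ Finset.range (L - t - 1 + 1), (2 * (k:ℝ) - ((L - t - 1 : ℕ) : ℝ)) * f (t + 1 + k) =
          2 * ∑ k ∈ Finset.range (L - t - 1 + 1), ((t + 1 + k : ℕ) : ℝ) * f (t + 1 + k) -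
            ((L:ℝ) + t + 1) * ∑ k ∈ Finset.range (L - t - 1 + 1), f (t + 1 + k) := by
        rw [Finset.mul_sum, Finset.mul_sum, ← Finset.sum_sub_distrib]
        refine Finset.sum_congr rfl fun k _ => ?_
        rw [Nat.cast_sub (by omega), Nat.cast_sub (by omega)]
        push_cast
        ring
      linarith
  rw [← hsplit, ← hsplitM]
  linarith

set_option quotPrecheck false in
/-- `Mass[n, f] = Σ_{k ≤ n} f k`. -/
local notation "Mass[" n ", " f "]" => ∑ k ∈ Finset.range (n + 1), f k

set_option quotPrecheck false in
/-- `Mom[n, f] = Σ_{k ≤ n} k · f k`. -/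
local notation "Mom[" n ", " f "]" => ∑ k ∈ Finset.range (n + 1), (k:ℝ) * f k

/-- **Pebody's Lemma 7** with the crossing argument of the proof of Cor. 8: for decreasing
`f₁, f₂, f₃` on `[0, L]` with equal masses, moments summing to `L ·` mass, and `f₂(L) = 0`,
`f₁(0) ≤ Σ_k min(f₂(k), f₃(L − k))` (printed: "`P(π₁ = 0) ≤ P(π₂ > t) + P(π₃ ≥ (p−1) − t)`" at
the crossing point `t`). [cite: Peabody2018, Lemma 7 and Corollary 8 (proof)] -/
theorem lemma7_cross {f₁ f₂ f₃ : ℕ → ℝ} {L : ℕ} (h₁ : Antitone f₁) (h₂ : Antitone f₂)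
    (h₃ : Antitone f₃) (hs₁ : ∀ k, L < k → f₁ k = 0) (hs₂ : ∀ k, L < k → f₂ k = 0)
    (hs₃ : ∀ k, L < k → f₃ k = 0) (hM₂ : Mass[L, f₂] = Mass[L, f₁])
    (hM₃ : Mass[L, f₃] = Mass[L, f₁])
    (hE : Mom[L, f₁] + Mom[L, f₂] + Mom[L, f₃] = L * Mass[L, f₁]) (hf₂L : f₂ L = 0) :
    f₁ 0 ≤ ∑ k ∈ Finset.range (L + 1), min (f₂ k) (f₃ (L - k)) := by
  have hn₁ := nonneg_of_antitone_of_vanish h₁ hs₁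
  have hn₂ := nonneg_of_antitone_of_vanish h₂ hs₂
  have hn₃ := nonneg_of_antitone_of_vanish h₃ hs₃
  have hf₁0 : f₁ 0 ≤ Mass[L, f₁] :=
    Finset.single_le_sum (fun k _ => hn₁ k) (Finset.mem_range.2 (Nat.succ_pos L))
  classical
  have hex : ∃ k, f₂ k ≤ f₃ (L - k) := ⟨L, by rw [hf₂L]; exact hn₃ _⟩
  set t₀ := Nat.find hex with ht₀
  have ht₀L : t₀ ≤ L := Nat.find_le (by rw [hf₂L]; exact hn₃ _)
  have hbelow : ∀ k, k < t₀ → f₃ (L - k) < f₂ k := fun k hk => lt_of_not_ge (Nat.find_min hex hk)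
  have habove : ∀ k, t₀ ≤ k → f₂ k ≤ f₃ (L - k) := fun k hk =>
    (h₂ hk).trans ((Nat.find_spec hex).trans (h₃ (by omega)))
  rcases Nat.eq_zero_or_pos t₀ with ht0 | ht0
  · -- every minimum is `f₂ k`
    have : ∑ k ∈ Finset.range (L + 1), min (f₂ k) (f₃ (L - k)) = Mass[L, f₂] :=
      Finset.sum_congr rfl fun k _ => min_eq_left (habove k (by omega))
    rw [this, hM₂]; exact hf₁0
  · obtain ⟨t, ht⟩ : ∃ t, t₀ = t + 1 := ⟨t₀ - 1, by omega⟩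
    rw [ht] at ht₀L hbelow habove
    have htL : t ≤ L - 1 := by omega
    have hsum : ∑ k ∈ Finset.range (L + 1), min (f₂ k) (f₃ (L - k)) =
        ∑ k ∈ Finset.range (t + 1), f₃ (L - k) + ∑ k ∈ Finset.Ico (t + 1) (L + 1), f₂ k := by
      rw [← Finset.sum_range_add_sum_Ico _ (show t + 1 ≤ L + 1 by omega)]
      congr 1
      · exact Finset.sum_congr rfl fun k hk =>
          min_eq_right (hbelow k (by simp only [Finset.mem_range] at hk; omega)).le
      · exact Finset.sum_congr rfl fun k hk =>
          min_eq_left (habove k (by simp only [Finset.mem_Ico] at hk; omega))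
    -- the three instances of Lemma 7
    have b₁ := lemma7_bound h₁ (Nat.zero_le L)
    have b₂ := lemma7_bound h₂ (show t ≤ L by omega)
    have b₃ := lemma7_bound h₃ (show L - 1 - t ≤ L by omega)
    simp only [zero_add, Finset.sum_range_one, Nat.cast_zero, zero_mul] at b₁
    have hcast : ((L - 1 - t : ℕ) : ℝ) = L - 1 - t := by
      rw [Nat.cast_sub (by omega), Nat.cast_sub (by omega)]; push_cast; ring
    rw [hcast, show L - 1 - t + 1 = L - t by omega] at b₃
    -- tail of `f₃` rewritten as a reflected head
    have htail₃ : Mass[L, f₃] - ∑ k ∈ Finset.range (L - t), f₃ k =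
        ∑ k ∈ Finset.range (t + 1), f₃ (L - k) := by
      rw [← Finset.sum_range_add_sum_Ico f₃ (show L - t ≤ L + 1 by omega), add_sub_cancel_left,
        Finset.sum_Ico_eq_sum_range, show L + 1 - (L - t) = t + 1 by omega,
        ← Finset.sum_flip (n := t) (fun k => f₃ (L - t + k))]
      exact Finset.sum_congr rfl fun k hk => by
        simp only [Finset.mem_range] at hk
        congr 1; omega
    have htail₂ : Mass[L, f₂] - ∑ k ∈ Finset.range (t + 1), f₂ k =
        ∑ k ∈ Finset.Ico (t + 1) (L + 1), f₂ k := by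
      rw [← Finset.sum_range_add_sum_Ico f₂ (show t + 1 ≤ L + 1 by omega), add_sub_cancel_left]
    rw [hsum, ← htail₃, ← htail₂]
    rw [hM₂, hM₃] at *
    have hL : (0:ℝ) < (L:ℝ) + 1 := by positivity
    nlinarith [b₁, b₂, b₃, hE, hL]

set_option quotPrecheck false in
/-- `Adm[m, f₁, f₂, f₃]`: three decreasing functions supported on `[0, m]` with equal masses and
moments summing to `m ·` mass (Pebody's hypothesis "decreasing distributions on `[p]` with
expected values summing to `p − 1`", unnormalised, `p = m + 1`). -/
local notation "Adm[" m ", " f₁ ", " f₂ ", " f₃ "]" =>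
  (Antitone f₁ ∧ Antitone f₂ ∧ Antitone f₃ ∧ (∀ k : ℕ, m < k → f₁ k = 0) ∧
    (∀ k : ℕ, m < k → f₂ k = 0) ∧ (∀ k : ℕ, m < k → f₃ k = 0) ∧
    Mass[m, f₂] = Mass[m, f₁] ∧ Mass[m, f₃] = Mass[m, f₁] ∧
    Mom[m, f₁] + Mom[m, f₂] + Mom[m, f₃] = (m:ℝ) * Mass[m, f₁])

/-- A reflected Kronecker sum. [folklore] -/
theorem sum_ite_eq_reflect (g : ℕ → ℝ) (L c : ℕ) (hg0 : g 0 = 0) :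
    ∑ k ∈ Finset.range (L + 1), (if c = L - k then g k else 0) = g (L - c) := by
  rw [Finset.sum_eq_single (L - c)]
  · by_cases hc : c ≤ L
    · rw [if_pos (by omega)]
    · rw [if_neg (by omega), show L - c = 0 by omega, hg0]
  · intro k hk hne
    simp only [Finset.mem_range] at hk
    rw [if_neg (by omega)]
  · intro h
    simp only [Finset.mem_range] at h
    omega

/-- **Pebody's Corollary 8** (the induction step): if every admissible triple at level `m` is
compatible, then so is every admissible triple `(f₁, f₂, f₃)` at level `m + 1` with
`f₂(m+1) = f₃(m+1) = 0`. The mass of `f₁` at `0` is spent on the triples `(0, k, m+1−k)` with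
weights `min(f₂(k), f₃(m+1−k), x)` (`x` chosen by the intermediate value theorem so that they sum to
`f₁(0)`, possible by Lemma 7); the residual distributions, with `f₁` shifted down by one, are
admissible at level `m`. [cite: Peabody2018, Corollary 8] -/
theorem cor8 {m : ℕ}
    (ih : ∀ g₁ g₂ g₃ : ℕ → ℝ, Adm[m, g₁, g₂, g₃] → ∃ w : ℕ → ℕ → ℕ → ℝ, Cpl[m, g₁, g₂, g₃, w])
    {f₁ f₂ f₃ : ℕ → ℝ} (hf : Adm[m + 1, f₁, f₂, f₃]) (hf₂ : f₂ (m + 1) = 0)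
    (hf₃ : f₃ (m + 1) = 0) : ∃ w : ℕ → ℕ → ℕ → ℝ, Cpl[m + 1, f₁, f₂, f₃, w] := by
  obtain ⟨ha₁, ha₂, ha₃, hs₁, hs₂, hs₃, hM₂, hM₃, hE⟩ := hf
  have hn₁ := nonneg_of_antitone_of_vanish ha₁ hs₁
  have hn₂ := nonneg_of_antitone_of_vanish ha₂ hs₂
  have hn₃ := nonneg_of_antitone_of_vanish ha₃ hs₃
  have hcross := lemma7_cross (L := m + 1) ha₁ ha₂ ha₃ hs₁ hs₂ hs₃ hM₂ hM₃ (by push_cast; exact hE) hf₂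
  -- choice of the cap `x`
  set φ : ℝ → ℝ := fun x => ∑ k ∈ Finset.range (m + 1 + 1), min (f₂ k) (min (f₃ (m + 1 - k)) x)
    with hφ
  have hφ0 : φ 0 = 0 := by
    refine Finset.sum_eq_zero fun k _ => ?_
    rw [min_eq_right (hn₃ _), min_eq_right (hn₂ k)]
  have hφ1 : φ (f₂ 0) = ∑ k ∈ Finset.range (m + 1 + 1), min (f₂ k) (f₃ (m + 1 - k)) := by
    refine Finset.sum_congr rfl fun k _ => ?_
    rw [← min_assoc, min_comm (f₂ k), min_assoc, min_eq_left (ha₂ (Nat.zero_le k))]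
  have hcont : Continuous φ :=
    continuous_finsetSum _ fun k _ => continuous_const.min (continuous_const.min continuous_id)
  obtain ⟨x, ⟨hx0, -⟩, hx⟩ := intermediate_value_Icc (hn₂ 0) hcont.continuousOn
    (show f₁ 0 ∈ Set.Icc (φ 0) (φ (f₂ 0)) from ⟨by rw [hφ0]; exact hn₁ 0, by rw [hφ1]; exact hcross⟩)
  -- the allocation `g`
  set g : ℕ → ℝ := fun k => min (f₂ k) (min (f₃ (m + 1 - k)) x) with hg
  have hgsum : ∑ k ∈ Finset.range (m + 1 + 1), g k = f₁ 0 := hx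
  have hg0 : ∀ k, 0 ≤ g k := fun k => le_min (hn₂ k) (le_min (hn₃ _) hx0)
  have hgf₂ : ∀ k, g k ≤ f₂ k := fun k => min_le_left _ _
  have hgf₃ : ∀ k, g k ≤ f₃ (m + 1 - k) := fun k => (min_le_right _ _).trans (min_le_left _ _)
  have hgL : g (m + 1) = 0 := le_antisymm (by simpa [hf₂] using hgf₂ (m + 1)) (hg0 _)
  have hg00 : g 0 = 0 := le_antisymm (by simpa [hf₃] using hgf₃ 0) (hg0 _)
  have hgvan : ∀ k, m + 1 < k → g k = 0 := fun k hk =>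
    le_antisymm (by simpa [hs₂ k hk] using hgf₂ k) (hg0 _)
  -- residuals
  set f₁' : ℕ → ℝ := fun k => f₁ (k + 1) with hf₁'
  set f₂' : ℕ → ℝ := fun k => f₂ k - g k with hf₂'
  set f₃' : ℕ → ℝ := fun c => f₃ c - g (m + 1 - c) with hf₃'
  have hf₃'alt : ∀ c, f₃' c = f₃ c - min (f₃ c) (min (f₂ (m + 1 - c)) x) := by
    intro c
    by_cases hc : c ≤ m + 1
    · simp only [hf₃', hg, show m + 1 - (m + 1 - c) = c by omega]
      rw [← min_assoc, min_comm (f₂ _), min_assoc]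
    · simp only [hf₃', show m + 1 - c = 0 by omega, hg00, hs₃ c (by omega)]
      rw [min_eq_left (le_min (hn₂ _) hx0)]
  -- sums of `g`
  have hgsum' : ∑ k ∈ Finset.range (m + 1), g k = f₁ 0 := by
    rw [Finset.sum_range_succ, hgL, add_zero] at hgsum; exact hgsum
  have hgsumr : ∑ c ∈ Finset.range (m + 1), g (m + 1 - c) = f₁ 0 := by
    have h := Finset.sum_flip (n := m + 1) g
    rw [Finset.sum_range_succ, Nat.sub_self, hg00, add_zero, hgsum] at h; exact h
  set G := ∑ k ∈ Finset.range (m + 1 + 1), (k:ℝ) * g k with hG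
  have hG' : ∑ k ∈ Finset.range (m + 1), (k:ℝ) * g k = G := by
    rw [hG, Finset.sum_range_succ _ (m + 1), hgL, mul_zero, add_zero]
  have hGr : ∑ c ∈ Finset.range (m + 1), (c:ℝ) * g (m + 1 - c) = ((m:ℝ) + 1) * f₁ 0 - G := by
    have h := Finset.sum_flip (n := m + 1) (fun k => (((m + 1 - k : ℕ)) : ℝ) * g k)
    have h1 : ∑ c ∈ Finset.range (m + 1 + 1), (((m + 1 - (m + 1 - c) : ℕ)) : ℝ) * g (m + 1 - c) =
        ∑ c ∈ Finset.range (m + 1 + 1), (c:ℝ) * g (m + 1 - c) :=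
      Finset.sum_congr rfl fun c hc => by
        simp only [Finset.mem_range] at hc
        rw [show m + 1 - (m + 1 - c) = c by omega]
    have h2 : ∑ k ∈ Finset.range (m + 1 + 1), (((m + 1 - k : ℕ)) : ℝ) * g k =
        ((m:ℝ) + 1) * f₁ 0 - G := by
      rw [← hgsum, hG, Finset.mul_sum, ← Finset.sum_sub_distrib]
      refine Finset.sum_congr rfl fun k hk => ?_
      simp only [Finset.mem_range] at hk
      rw [Nat.cast_sub (by omega)]; push_cast; ring
    rw [h1, h2, Finset.sum_range_succ, Nat.sub_self, hg00, mul_zero, add_zero] at h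
    exact h
  -- masses and moments of the residuals
  have hM : Mass[m + 1, f₁] = Mass[m, f₁'] + f₁ 0 := by
    rw [Finset.sum_range_succ']
  have hM₁' : Mass[m, f₁'] = Mass[m + 1, f₁] - f₁ 0 := by linarith
  have hM₂' : Mass[m, f₂'] = Mass[m + 1, f₁] - f₁ 0 := by
    simp only [hf₂', Finset.sum_sub_distrib, hgsum', ← hM₂]
    rw [Finset.sum_range_succ _ (m + 1), hf₂, add_zero]
  have hM₃' : Mass[m, f₃'] = Mass[m + 1, f₁] - f₁ 0 := by
    simp only [hf₃', Finset.sum_sub_distrib, hgsumr, ← hM₃]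
    rw [Finset.sum_range_succ _ (m + 1), hf₃, add_zero]
  have hE₁' : Mom[m, f₁'] = Mom[m + 1, f₁] - (Mass[m + 1, f₁] - f₁ 0) := by
    rw [← hM₁', Finset.sum_range_succ' (fun k => (k:ℝ) * f₁ k)]
    simp only [Nat.cast_zero, zero_mul, add_zero, Nat.cast_succ, add_mul, one_mul,
      Finset.sum_add_distrib]
    ring
  have hE₂' : Mom[m, f₂'] = Mom[m + 1, f₂] - G := by
    simp only [hf₂', mul_sub, Finset.sum_sub_distrib, hG']
    rw [Finset.sum_range_succ _ (m + 1), hf₂, mul_zero, add_zero]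
  have hE₃' : Mom[m, f₃'] = Mom[m + 1, f₃] - (((m:ℝ) + 1) * f₁ 0 - G) := by
    simp only [hf₃', mul_sub, Finset.sum_sub_distrib, hGr]
    rw [Finset.sum_range_succ _ (m + 1), hf₃, mul_zero, add_zero]
  -- admissibility of the residuals
  have adm' : Adm[m, f₁', f₂', f₃'] := by
    refine ⟨fun a b hab => ha₁ (by omega), ?_, ?_, fun k hk => hs₁ _ (by omega), fun k hk => ?_,
      fun k hk => ?_, by rw [hM₂', hM₁'], by rw [hM₃', hM₁'], ?_⟩
    · exact antitone_sub_min ha₂ (fun a b hab => ha₃ (by omega)) x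
    · rw [show f₃' = fun c => f₃ c - min (f₃ c) (min (f₂ (m + 1 - c)) x) from funext hf₃'alt]
      exact antitone_sub_min ha₃ (fun a b hab => ha₂ (by omega)) x
    · show f₂ k - g k = 0
      rcases Nat.eq_or_lt_of_le (show m + 1 ≤ k by omega) with h | h
      · rw [← h, hf₂, hgL]; ring
      · rw [hs₂ k h, hgvan k h]; ring
    · show f₃ k - g (m + 1 - k) = 0
      rw [show m + 1 - k = 0 by omega, hg00, sub_zero]
      rcases Nat.eq_or_lt_of_le (show m + 1 ≤ k by omega) with h | h
      · rw [← h, hf₃]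
      · exact hs₃ k h
    · rw [hE₁', hE₂', hE₃', hM₁']
      linarith
  -- assemble
  obtain ⟨w', hw'⟩ := ih f₁' f₂' f₃' adm'
  have hS := cpl_shift1 hw' 1
  have hP := cpl_sum (Finset.range (m + 1 + 1)) (m := m + 1)
    (f₁ := fun k a => if a = 0 then g k else 0) (f₂ := fun k b => if b = k then g k else 0)
    (f₃ := fun k c => if c = m + 1 - k then g k else 0)
    (w := fun k a b c => (if a = 0 then (1:ℝ) else 0) * (if b = k then (1:ℝ) else 0) *
      (if c = m + 1 - k then g k else 0))
    (fun k hk => cpl_point (by simp only [Finset.mem_range] at hk; omega) (hg0 k))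
  have h := cpl_add hS hP zero_le_one zero_le_one
  refine ⟨_, cpl_congr h (fun a => ?_) (fun b => ?_) (fun c => ?_)⟩
  · rcases Nat.eq_zero_or_pos a with rfl | ha
    · simp [hgsum]
    · have ha1 : 1 ≤ a := ha
      rw [if_pos ha1, Finset.sum_eq_zero fun k _ => if_neg (by omega)]
      simp only [hf₁', show a - 1 + 1 = a by omega]; ring
  · rw [Finset.sum_ite_eq]
    simp only [hf₂', Finset.mem_range]
    split_ifs with hb
    · ring
    · rw [hgvan b (by omega)]; ring
  · rw [sum_ite_eq_reflect g (m + 1) c hg00]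
    simp only [hf₃']; ring

/-! ### Simple triples (Pebody's Corollary 6 cases) -/

/-- `U_n` is decreasing. [folklore] -/
theorem U_antitone (n : ℕ) : Antitone (𝑈 n) := by
  intro a b hab
  dsimp only
  split_ifs with h1 h2 h2
  · exact le_rfl
  · omega
  · positivity
  · exact le_rfl

/-- `U_n` vanishes above `n`. [folklore] -/
theorem U_vanish (n : ℕ) : ∀ j, n < j → 𝑈 n j = 0 := fun j hj => by
  dsimp only; rw [if_neg (by omega)]

/-- `U_n ≥ 0`. [folklore] -/
theorem U_nonneg (n j : ℕ) : 0 ≤ 𝑈 n j := by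
  dsimp only; split_ifs <;> positivity

/-- `U_n` has mass `1` on `[0, L] ⊇ [0, n]`. [folklore] -/
theorem U_mass {n L : ℕ} (hn : n ≤ L) : Mass[L, 𝑈 n] = 1 := by
  rw [eventually_constant_sum (N := n + 1) (U_vanish n) (by omega)]
  rw [Finset.sum_congr rfl fun j hj => if_pos (by simp only [Finset.mem_range] at hj; omega),
    Finset.sum_const, Finset.card_range, nsmul_eq_mul]
  push_cast
  exact mul_inv_cancel₀ (by positivity)

/-- `U_n` has mean `n/2`: `2 Σ_j j U_n(j) = n`. [folklore] -/
theorem U_mom {n L : ℕ} (hn : n ≤ L) : 2 * Mom[L, 𝑈 n] = n := by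
  have hvan : ∀ j, n < j → (j:ℝ) * 𝑈 n j = 0 := fun j hj => by
    dsimp only; rw [if_neg (by omega), mul_zero]
  rw [eventually_constant_sum (N := n + 1) (u := fun j => (j:ℝ) * 𝑈 n j) hvan (by omega)]
  have hterm : ∀ j ∈ Finset.range (n + 1), (j:ℝ) * 𝑈 n j = (j:ℝ) * ((n:ℝ) + 1)⁻¹ := fun j hj => by
    dsimp only; rw [if_pos (by simp only [Finset.mem_range] at hj; omega)]
  rw [Finset.sum_congr rfl hterm, ← Finset.sum_mul]
  have h := Finset.sum_range_id_mul_two (n + 1)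
  have h' : (∑ i ∈ Finset.range (n + 1), (i:ℝ)) * 2 = ((n:ℝ) + 1) * n := by
    have := congrArg (fun x : ℕ => (x:ℝ)) h
    push_cast at this
    simpa using this
  have hn1 : (0:ℝ) < (n:ℝ) + 1 := by positivity
  field_simp
  linarith

/-- Permuting an admissible triple (swap of the first two). [folklore] -/
theorem adm_swap12 {m : ℕ} {f₁ f₂ f₃ : ℕ → ℝ} (h : Adm[m, f₁, f₂, f₃]) : Adm[m, f₂, f₁, f₃] := by
  obtain ⟨a₁, a₂, a₃, s₁, s₂, s₃, M₂, M₃, E⟩ := h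
  exact ⟨a₂, a₁, a₃, s₂, s₁, s₃, M₂.symm, M₃.trans M₂.symm, by rw [M₂]; linarith⟩

/-- Permuting an admissible triple (swap of the last two). [folklore] -/
theorem adm_swap23 {m : ℕ} {f₁ f₂ f₃ : ℕ → ℝ} (h : Adm[m, f₁, f₂, f₃]) : Adm[m, f₁, f₃, f₂] := by
  obtain ⟨a₁, a₂, a₃, s₁, s₂, s₃, M₂, M₃, E⟩ := h
  exact ⟨a₁, a₃, a₂, s₁, s₃, s₂, M₃, M₂, by linarith⟩

/-- Permuting an admissible triple (swap of the first and the last). [folklore] -/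
theorem adm_swap13 {m : ℕ} {f₁ f₂ f₃ : ℕ → ℝ} (h : Adm[m, f₁, f₂, f₃]) : Adm[m, f₃, f₂, f₁] :=
  adm_swap23 (adm_swap12 (adm_swap23 h))

/-- The simple triple `(U_k, U_l, λU_y + (1−λ)U_z)` with `k + l + λy + (1−λ)z = 2L` is admissible
at level `L`. [cite: Peabody2018, Corollary 6] -/
theorem adm_simple {L k l y z : ℕ} {lam : ℝ} (hk : k ≤ L) (hl : l ≤ L) (hy : y ≤ L) (hz : z ≤ L)
    (h0 : 0 ≤ lam) (h1 : lam ≤ 1) (hsum : (k:ℝ) + l + lam * y + (1 - lam) * z = 2 * L) :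
    Adm[L, 𝑈 k, 𝑈 l, fun j => lam * 𝑈 y j + (1 - lam) * 𝑈 z j] := by
  refine ⟨U_antitone k, U_antitone l, ?_, fun j hj => U_vanish k j (by omega),
    fun j hj => U_vanish l j (by omega), fun j hj => ?_, ?_, ?_, ?_⟩
  · exact ((U_antitone y).const_mul h0).add ((U_antitone z).const_mul (by linarith))
  · show lam * 𝑈 y j + (1 - lam) * 𝑈 z j = 0
    rw [U_vanish y j (by omega), U_vanish z j (by omega)]; ring
  · rw [U_mass hk, U_mass hl]
  · show ∑ j ∈ Finset.range (L + 1), (lam * 𝑈 y j + (1 - lam) * 𝑈 z j) = Mass[L, 𝑈 k]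
    rw [Finset.sum_add_distrib, ← Finset.mul_sum, ← Finset.mul_sum, U_mass hy, U_mass hz,
      U_mass hk]; ring
  · show Mom[L, 𝑈 k] + Mom[L, 𝑈 l] +
        ∑ j ∈ Finset.range (L + 1), (j:ℝ) * (lam * 𝑈 y j + (1 - lam) * 𝑈 z j) = L * Mass[L, 𝑈 k]
    have e3 : ∑ j ∈ Finset.range (L + 1), (j:ℝ) * (lam * 𝑈 y j + (1 - lam) * 𝑈 z j) =
        lam * Mom[L, 𝑈 y] + (1 - lam) * Mom[L, 𝑈 z] := by
      rw [Finset.mul_sum, Finset.mul_sum, ← Finset.sum_add_distrib]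
      exact Finset.sum_congr rfl fun j _ => by ring
    rw [e3, U_mass hk]
    have := U_mom hk; have := U_mom hl; have := U_mom hy; have := U_mom hz
    nlinarith

/-- The simple triples `(U_L, U_l, λU_y + (1−λ)U_L)` with `l = λ(L − y)` are compatible: for
`y = L` this is `(U_L, U_0, U_L)` (§5), for `λ = 1` it is Lemma 9, and otherwise Corollary 10.
[cite: Peabody2018, §5] -/
theorem simple_charging (L l y : ℕ) (lam : ℝ) (hy : y ≤ L) (h0 : 0 ≤ lam) (h1 : lam ≤ 1)
    (hl : (l:ℝ) = lam * ((L:ℝ) - y)) :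
    ∃ w : ℕ → ℕ → ℕ → ℝ, Cpl[L, 𝑈 L, 𝑈 l, fun j => lam * 𝑈 y j + (1 - lam) * 𝑈 L j, w] := by
  rcases Nat.eq_or_lt_of_le hy with rfl | hyL
  · -- `l = 0`, `V = U_L`
    have hl0 : l = 0 := by
      have : (l:ℝ) = 0 := by rw [hl]; ring
      exact_mod_cast this
    subst hl0
    obtain ⟨w, hw⟩ := cpl_uniform_uniform_zero y
    exact ⟨_, cpl_congr (cpl_swap23 hw) (fun k => rfl) (fun k => rfl) (fun k => by ring)⟩
  have hLy : (0:ℝ) < (L:ℝ) - y := by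
    have : (y:ℝ) < L := by exact_mod_cast hyL
    linarith
  rcases eq_or_lt_of_le h1 with rfl | hlam
  · -- `λ = 1`: `l = L − y`, `V = U_y`, Lemma 9
    have hl' : l = L - y := by
      have : (l:ℝ) = ((L - y : ℕ) : ℝ) := by rw [hl, Nat.cast_sub hy]; ring
      exact_mod_cast this
    subst hl'
    obtain ⟨w, hw⟩ := lemma9 L (L - y) y (by omega)
    rw [show L - y + y = L by omega] at hw
    exact ⟨_, cpl_congr (cpl_swap23 (cpl_swap13 hw)) (fun k => rfl) (fun k => rfl)
      (fun k => by ring)⟩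
  · -- `λ < 1`: Corollary 10 with `r = L − y − l − 1`
    have hlt : l + y < L := by
      have : (l:ℝ) < (L:ℝ) - y := by rw [hl]; nlinarith
      have : (l:ℝ) + y < L := by linarith
      exact_mod_cast this
    obtain ⟨w, hw⟩ := cor10 l y (L - y - l - 1)
    rw [show l + y + 1 + (L - y - l - 1) = L by omega] at hw
    have hden : (l:ℝ) + ((L - y - l - 1 : ℕ) : ℝ) + 1 = (L:ℝ) - y := by
      rw [Nat.cast_sub (by omega), Nat.cast_sub (by omega), Nat.cast_sub (by omega)]
      push_cast; ring
    have hlam' : (l:ℝ) / ((l:ℝ) + ((L - y - l - 1 : ℕ) : ℝ) + 1) = lam := by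
      rw [hden, hl]; field_simp
    refine ⟨_, cpl_congr (cpl_swap12 hw) (fun k => rfl) (fun k => rfl) (fun k => ?_)⟩
    beta_reduce
    rw [hlam']

/-- **Simple triples are compatible** (Pebody, §5: every simple admissible triple
`(U_k, U_l, λU_y + (1−λ)U_z)` at level `L` is compatible, given Corollary 8 at level `L` for the
cases where at most one of the three distributions charges `L`, and the explicit constructions
otherwise). [cite: Peabody2018, §5 (proof of Theorem 4)] -/
theorem simple_of_cor8 {L : ℕ}
    (hA : ∀ f₁ f₂ f₃ : ℕ → ℝ, Adm[L, f₁, f₂, f₃] → f₂ L = 0 → f₃ L = 0 →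
      ∃ w : ℕ → ℕ → ℕ → ℝ, Cpl[L, f₁, f₂, f₃, w])
    {k l y z : ℕ} {lam : ℝ} (hk : k ≤ L) (hl : l ≤ L) (hyz : y ≤ z) (hz : z ≤ L) (h0 : 0 ≤ lam)
    (h1 : lam ≤ 1) (hsum : (k:ℝ) + l + lam * y + (1 - lam) * z = 2 * L) :
    ∃ w : ℕ → ℕ → ℕ → ℝ, Cpl[L, 𝑈 k, 𝑈 l, fun j => lam * 𝑈 y j + (1 - lam) * 𝑈 z j, w] := by
  have hy : y ≤ L := hyz.trans hz
  have hadm := adm_simple hk hl hy hz h0 h1 hsum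
  by_cases hkL : k = L
  · subst hkL
    by_cases hlL : l = k
    · subst hlL
      -- `V = U_0`
      have hyz0 : lam * y = 0 ∧ (1 - lam) * z = 0 := by
        have h1' : lam * y + (1 - lam) * z = 0 := by linarith
        have a : 0 ≤ lam * y := by positivity
        have b : 0 ≤ (1 - lam) * z := mul_nonneg (by linarith) (by positivity)
        constructor <;> linarith
      obtain ⟨w, hw⟩ := cpl_uniform_uniform_zero l
      refine ⟨_, cpl_congr hw (fun j => rfl) (fun j => rfl) (fun j => ?_)⟩
      beta_reduce
      rcases eq_or_ne lam 0 with rfl | hlam0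
      · have hz0 : z = 0 := by exact_mod_cast (show (z:ℝ) = 0 by linarith [hyz0.2])
        have hy0 : y = 0 := by omega
        subst hz0; subst hy0; ring
      · have hy0 : y = 0 := by
          have := hyz0.1
          rcases mul_eq_zero.1 this with h | h
          · exact absurd h hlam0
          · exact_mod_cast h
        subst hy0
        rcases eq_or_ne lam 1 with rfl | hlam1
        · ring
        · have hz0 : z = 0 := by
            rcases mul_eq_zero.1 hyz0.2 with h | h
            · exact absurd (by linarith : lam = 1) hlam1
            · exact_mod_cast h
          subst hz0; ring
    · by_cases hzL : z = k
      · subst hzL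
        exact simple_charging z l y lam hy h0 h1 (by linarith)
      · have hlk : l < k := lt_of_le_of_ne hl hlL
        have hzk : z < k := lt_of_le_of_ne hz hzL
        refine hA _ _ _ hadm (U_vanish l k hlk) ?_
        show lam * 𝑈 y k + (1 - lam) * 𝑈 z k = 0
        rw [U_vanish y k (by omega), U_vanish z k hzk]; ring
  · have hkL' : k < L := lt_of_le_of_ne hk hkL
    by_cases hlL : l = L
    · subst hlL
      by_cases hzL : z = l
      · subst hzL
        obtain ⟨w, hw⟩ := simple_charging z k y lam hy h0 h1 (by linarith)
        exact ⟨_, cpl_swap12 hw⟩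
      · have hzl : z < l := lt_of_le_of_ne hz hzL
        obtain ⟨w, hw⟩ := hA _ _ _ (adm_swap12 hadm) (U_vanish k l hkL') (by
          show lam * 𝑈 y l + (1 - lam) * 𝑈 z l = 0
          rw [U_vanish y l (by omega), U_vanish z l hzl]; ring)
        exact ⟨_, cpl_swap12 hw⟩
    · have hlL' : l < L := lt_of_le_of_ne hl hlL
      obtain ⟨w, hw⟩ := hA _ _ _ (adm_swap12 (adm_swap23 hadm)) (U_vanish k L hkL')
        (U_vanish l L hlL')
      exact ⟨_, cpl_swap23 (cpl_swap12 hw)⟩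

/-! ### Lemma 5: reduction to simple triples -/

set_option quotPrecheck false in
/-- `Jmp[m, f]`: the jump set `{j ≤ m : f(j+1) < f(j)}` of `f`. -/
local notation "Jmp[" m ", " f "]" =>
  Finset.filter (fun j : ℕ => f (j + 1) < f j) (Finset.range (m + 1))

/-- A decreasing function vanishing above `m` without jumps in `[0, m]` vanishes identically.
[folklore] -/
theorem eq_zero_of_jumps_empty {m : ℕ} {f : ℕ → ℝ} (hf : Antitone f)
    (hs : ∀ k, m < k → f k = 0) (hJ : Jmp[m, f] = ∅) (k : ℕ) : f k = 0 := by
  have step : ∀ j, j ≤ m → f j = f (j + 1) := by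
    intro j hj
    have : ¬ (f (j + 1) < f j) := by
      intro hlt
      have : j ∈ Jmp[m, f] := Finset.mem_filter.2 ⟨Finset.mem_range.2 (by omega), hlt⟩
      rw [hJ] at this; simp at this
    exact le_antisymm (not_lt.1 this) (hf (Nat.le_succ j))
  by_cases hk : k ≤ m
  · have : ∀ d, k + d ≤ m + 1 → f k = f (k + d) := by
      intro d
      induction d with
      | zero => intro; rfl
      | succ d ih => intro hd; rw [ih (by omega), step (k + d) (by omega)]; rfl
    rw [this (m + 1 - k) (by omega)]
    exact hs _ (by omega)
  · exact hs k (by omega)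

/-- The coupling of an admissible triple of mass zero. [folklore] -/
theorem cpl_of_mass_zero {m : ℕ} {f₁ f₂ f₃ : ℕ → ℝ} (h : Adm[m, f₁, f₂, f₃])
    (hM : Mass[m, f₁] = 0) : ∃ w : ℕ → ℕ → ℕ → ℝ, Cpl[m, f₁, f₂, f₃, w] := by
  obtain ⟨a₁, a₂, a₃, s₁, s₂, s₃, M₂, M₃, -⟩ := h
  have z : ∀ {f : ℕ → ℝ}, Antitone f → (∀ k, m < k → f k = 0) → Mass[m, f] = 0 → ∀ k, f k = 0 := by
    intro f hf hs hm k
    by_cases hk : k ≤ m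
    · exact (Finset.sum_eq_zero_iff_of_nonneg fun j _ => nonneg_of_antitone_of_vanish hf hs j).1 hm
        k (Finset.mem_range.2 (by omega))
    · exact hs k (by omega)
  refine ⟨_, cpl_congr (cpl_zero m) (fun k => (z a₁ s₁ hM k).symm)
    (fun k => (z a₂ s₂ (M₂.trans hM) k).symm) (fun k => (z a₃ s₃ (M₃.trans hM) k).symm)⟩

/-- Below its first jump a decreasing function is constant. [folklore] -/
theorem eq_of_lt_min_jump {m : ℕ} {f : ℕ → ℝ} (hf : Antitone f) {lo : ℕ}
    (hlo : ∀ j, j < lo → j ≤ m → ¬ (f (j + 1) < f j)) (hlom : lo ≤ m) :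
    ∀ k, k ≤ lo → f k = f 0 := by
  intro k hk
  induction k with
  | zero => rfl
  | succ k ih =>
    rw [← ih (by omega)]
    exact le_antisymm (hf (Nat.le_succ k)) (not_lt.1 (hlo k (by omega) (by omega)))

/-- Above its last jump a decreasing function supported on `[0, m]` vanishes. [folklore] -/
theorem eq_zero_of_max_jump_lt {m : ℕ} {f : ℕ → ℝ} (hf : Antitone f)
    (hs : ∀ k, m < k → f k = 0) {hi : ℕ}
    (hhi : ∀ j, hi < j → j ≤ m → ¬ (f (j + 1) < f j)) : ∀ k, hi < k → f k = 0 := by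
  have step : ∀ j, hi < j → j ≤ m → f j = f (j + 1) := fun j h1 h2 =>
    le_antisymm (not_lt.1 (hhi j h1 h2)) (hf (Nat.le_succ j))
  intro k hk
  by_cases hkm : k ≤ m
  · have : ∀ d, k + d ≤ m + 1 → f k = f (k + d) := by
      intro d
      induction d with
      | zero => intro; rfl
      | succ d ih => intro hd; rw [ih (by omega), step (k + d) (by omega) (by omega)]; rfl
    rw [this (m + 1 - k) (by omega)]
    exact hs _ (by omega)
  · exact hs k (by omega)

/-- Lower moment bound: if `f` is constant on `[0, lo]` then `lo · Mass ≤ 2 · Mom`.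
[cite: Peabody2018, Lemma 5 (proof)] -/
theorem lo_mul_mass_le {m : ℕ} {f : ℕ → ℝ} (hf : Antitone f) (hs : ∀ k, m < k → f k = 0)
    {lo : ℕ} (hlom : lo ≤ m) (hconst : ∀ k, k ≤ lo → f k = f 0) :
    (lo:ℝ) * Mass[m, f] ≤ 2 * Mom[m, f] := by
  have hn := nonneg_of_antitone_of_vanish hf hs
  suffices h : 0 ≤ ∑ k ∈ Finset.range (m + 1), (2 * (k:ℝ) - lo) * f k by
    have : ∑ k ∈ Finset.range (m + 1), (2 * (k:ℝ) - lo) * f k = 2 * Mom[m, f] - lo * Mass[m, f] := by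
      rw [Finset.mul_sum, Finset.mul_sum, ← Finset.sum_sub_distrib]
      exact Finset.sum_congr rfl fun k _ => by ring
    linarith
  rw [← Finset.sum_range_add_sum_Ico _ (show lo + 1 ≤ m + 1 by omega)]
  refine add_nonneg (le_of_eq ?_) (Finset.sum_nonneg fun k hk => ?_)
  · -- `Σ_{k ≤ lo} (2k − lo) f(0) = 0`
    rw [Finset.sum_congr rfl fun k hk => by
      rw [hconst k (by simp only [Finset.mem_range] at hk; omega)], ← Finset.sum_mul]
    have h := Finset.sum_range_id_mul_two (lo + 1)
    have h' : (∑ i ∈ Finset.range (lo + 1), (i:ℝ)) * 2 = ((lo:ℝ) + 1) * lo := by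
      have := congrArg (fun x : ℕ => (x:ℝ)) h
      push_cast at this
      simpa using this
    have : ∑ k ∈ Finset.range (lo + 1), (2 * (k:ℝ) - lo) = 0 := by
      rw [Finset.sum_sub_distrib, ← Finset.mul_sum, Finset.sum_const, Finset.card_range,
        nsmul_eq_mul]
      push_cast
      linarith
    rw [this, zero_mul]
  · simp only [Finset.mem_Ico] at hk
    exact mul_nonneg (by
      have : (lo:ℝ) + 1 ≤ k := by exact_mod_cast hk.1
      linarith) (hn k)

/-- Upper moment bound: if `f` vanishes above `hi ≤ m` then `2 · Mom ≤ hi · Mass`.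
[cite: Peabody2018, Lemma 5 (proof)] -/
theorem two_mul_mom_le {m : ℕ} {f : ℕ → ℝ} (hf : Antitone f) {hi : ℕ} (hhim : hi ≤ m)
    (hzero : ∀ k, hi < k → f k = 0) : 2 * Mom[m, f] ≤ (hi:ℝ) * Mass[m, f] := by
  have h1 : Mom[m, f] = Mom[hi, f] :=
    eventually_constant_sum (N := hi + 1) (fun k hk => by rw [hzero k hk, mul_zero]) (by omega)
  have h2 : Mass[m, f] = Mass[hi, f] := eventually_constant_sum (N := hi + 1) hzero (by omega)
  rw [h1, h2]
  have h := sum_two_mul_sub_mul_nonpos hf hi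
  have : ∑ k ∈ Finset.range (hi + 1), (2 * (k:ℝ) - hi) * f k = 2 * Mom[hi, f] - hi * Mass[hi, f] := by
    rw [Finset.mul_sum, Finset.mul_sum, ← Finset.sum_sub_distrib]
    exact Finset.sum_congr rfl fun k _ => by ring
  linarith

/-- The jump of `U_n`: only at `n`, of size `1/(n+1)`. [folklore] -/
theorem U_jump (n j : ℕ) : 𝑈 n j - 𝑈 n (j + 1) = if j = n then ((n:ℝ) + 1)⁻¹ else 0 := by
  dsimp only
  by_cases h : j = n
  · subst h; simp
  · rw [if_neg h]
    by_cases h' : j ≤ n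
    · rw [if_pos h', if_pos (by omega), sub_self]
    · rw [if_neg h', if_neg (by omega), sub_self]

/-- Subtracting `t · s` from `f` along the jumps (Pebody, proof of Lemma 5): if
`t (s(j) − s(j+1)) ≤ f(j) − f(j+1)` at every jump of `s` (for `j ≤ m`), then `f − t s` is
decreasing, supported on `[0, m]`, its jumps are jumps of `f`, and its mass and moment drop by
`t ·` those of `s`. [cite: Peabody2018, Lemma 5 (proof)] -/
theorem pair_facts {m : ℕ} {f s : ℕ → ℝ} (hf : Antitone f) (hs : Antitone s)
    (hfv : ∀ k, m < k → f k = 0) (hsv : ∀ k, m < k → s k = 0) {t : ℝ} (ht0 : 0 ≤ t)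
    (ht : ∀ j ∈ Finset.range (m + 1), 0 < s j - s (j + 1) → t ≤ (f j - f (j + 1)) / (s j - s (j + 1))) :
    Antitone (fun j => f j - t * s j) ∧ (∀ k, m < k → f k - t * s k = 0) ∧
      Jmp[m, fun j => f j - t * s j] ⊆ Jmp[m, f] ∧
      Mass[m, fun j => f j - t * s j] = Mass[m, f] - t * Mass[m, s] ∧
      Mom[m, fun j => f j - t * s j] = Mom[m, f] - t * Mom[m, s] := by
  refine ⟨antitone_nat_of_succ_le fun j => ?_, fun k hk => by rw [hfv k hk, hsv k hk]; ring,
    fun j hj => ?_, ?_, ?_⟩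
  · show f (j + 1) - t * s (j + 1) ≤ f j - t * s j
    have hsj : s (j + 1) ≤ s j := hs (Nat.le_succ j)
    have hfj : f (j + 1) ≤ f j := hf (Nat.le_succ j)
    rcases lt_or_ge 0 (s j - s (j + 1)) with hpos | hle
    · by_cases hjm : j ≤ m
      · have h := ht j (Finset.mem_range.2 (by omega)) hpos
        rw [le_div_iff₀ hpos] at h
        linarith
      · rw [hsv j (by omega), hsv (j + 1) (by omega)] at hpos; simp at hpos
    · have : s (j + 1) = s j := by linarith
      rw [this]; linarith
  · simp only [Finset.mem_filter] at hj ⊢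
    refine ⟨hj.1, ?_⟩
    have := mul_le_mul_of_nonneg_left (hs (Nat.le_succ j)) ht0
    linarith [hj.2]
  · rw [Finset.sum_sub_distrib, Finset.mul_sum]
  · rw [Finset.mul_sum, ← Finset.sum_sub_distrib]
    exact Finset.sum_congr rfl fun k _ => by ring

/-- If moreover `t` is attained at a jump `j₀` of `f` (`t (s(j₀) − s(j₀+1)) = f(j₀) − f(j₀+1)`),
then `f − t s` has strictly fewer jumps than `f`. [cite: Peabody2018, Lemma 5 (proof)] -/
theorem card_jumps_lt {m : ℕ} {f s : ℕ → ℝ} {t : ℝ}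
    (hsub : Jmp[m, fun j => f j - t * s j] ⊆ Jmp[m, f])
    {j₀ : ℕ} (hj₀ : j₀ ∈ Jmp[m, f]) (heq : t * (s j₀ - s (j₀ + 1)) = f j₀ - f (j₀ + 1)) :
    (Jmp[m, fun j => f j - t * s j]).card < (Jmp[m, f]).card := by
  refine Finset.card_lt_card ((Finset.ssubset_iff_of_subset hsub).2 ⟨j₀, hj₀, ?_⟩)
  simp only [Finset.mem_filter, not_and, not_lt]
  intro _
  linarith

set_option quotPrecheck false in
/-- `HSm[m]`: every simple admissible triple `(U_k, U_l, λU_y + (1−λ)U_z)` at level `m` is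
compatible. -/
local notation "HSm[" m "]" =>
  (∀ (k l y z : ℕ) (lam : ℝ), k ≤ m → l ≤ m → y ≤ z → z ≤ m → 0 ≤ lam → lam ≤ 1 →
    (k:ℝ) + l + lam * y + (1 - lam) * z = 2 * m →
    ∃ w : ℕ → ℕ → ℕ → ℝ, Cpl[m, 𝑈 k, 𝑈 l, fun j => lam * 𝑈 y j + (1 - lam) * 𝑈 z j, w])

/-- **Pebody's Lemma 5, one peeling step** (with the roles arranged so that the third
distribution carries the two-level part): given jumps `k₁` of `f₁`, `k₂` of `f₂` and jumps
`y ≤ z` of `f₃` with `y ≤ 2m − k₁ − k₂ ≤ z`, subtract the largest multiple `t` of the simple triple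
`(U_{k₁}, U_{k₂}, λU_y + (1−λ)U_z)` keeping the triple admissible; this kills a jump, so the
induction hypothesis (fewer jumps) and the compatibility of simple triples finish.
[cite: Peabody2018, Lemma 5 and Corollary 6] -/
theorem stepB_core {m : ℕ} (HS : HSm[m]) {f₁ f₂ f₃ : ℕ → ℝ} (hadm : Adm[m, f₁, f₂, f₃])
    (ih : ∀ g₁ g₂ g₃ : ℕ → ℝ, Adm[m, g₁, g₂, g₃] →
      (Jmp[m, g₁]).card + (Jmp[m, g₂]).card + (Jmp[m, g₃]).card <
        (Jmp[m, f₁]).card + (Jmp[m, f₂]).card + (Jmp[m, f₃]).card →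
      ∃ w : ℕ → ℕ → ℕ → ℝ, Cpl[m, g₁, g₂, g₃, w])
    {k₁ k₂ y z : ℕ} (hk₁ : k₁ ∈ Jmp[m, f₁]) (hk₂ : k₂ ∈ Jmp[m, f₂]) (hy : y ∈ Jmp[m, f₃])
    (hz : z ∈ Jmp[m, f₃]) (hyz : y ≤ z) (hx₁ : (y:ℝ) ≤ 2 * m - k₁ - k₂)
    (hx₂ : 2 * (m:ℝ) - k₁ - k₂ ≤ z) : ∃ w : ℕ → ℕ → ℕ → ℝ, Cpl[m, f₁, f₂, f₃, w] := by
  obtain ⟨a₁, a₂, a₃, v₁, v₂, v₃, M₂, M₃, E⟩ := hadm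
  have hk₁' := hk₁; have hk₂' := hk₂; have hy' := hy; have hz' := hz
  simp only [Finset.mem_filter, Finset.mem_range] at hk₁' hk₂' hy' hz'
  -- the mixing parameter
  obtain ⟨lam, h0, h1, hsum⟩ : ∃ lam : ℝ, 0 ≤ lam ∧ lam ≤ 1 ∧
      (k₁:ℝ) + k₂ + lam * y + (1 - lam) * z = 2 * m := by
    rcases Nat.eq_or_lt_of_le hyz with rfl | hlt
    · exact ⟨1, zero_le_one, le_rfl, by linarith⟩
    · have hzy : (0:ℝ) < (z:ℝ) - y := by
        have : (y:ℝ) < z := by exact_mod_cast hlt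
        linarith
      refine ⟨((z:ℝ) - (2 * m - k₁ - k₂)) / ((z:ℝ) - y), div_nonneg (by linarith) hzy.le,
        (div_le_one hzy).2 (by linarith), ?_⟩
      field_simp
      ring
  -- the simple triple and its facts (before naming it)
  obtain ⟨v, hv⟩ := HS k₁ k₂ y z lam (by omega) (by omega) hyz (by omega) h0 h1 hsum
  obtain ⟨b₁, b₂, b₃, u₁, u₂, u₃, N₂, N₃, F⟩ :=
    adm_simple (L := m) (k := k₁) (l := k₂) (by omega) (by omega) (by omega : y ≤ m) (by omega)
      h0 h1 hsum
  have hms₁ : Mass[m, 𝑈 k₁] = 1 := U_mass (by omega)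
  have hJ₁ := U_jump k₁; have hJ₂ := U_jump k₂; have hJy := U_jump y; have hJz := U_jump z
  set s₁ : ℕ → ℝ := 𝑈 k₁ with hs₁
  set s₂ : ℕ → ℝ := 𝑈 k₂ with hs₂
  set Uy : ℕ → ℝ := 𝑈 y with hUy
  set Uz : ℕ → ℝ := 𝑈 z with hUz
  set s₃ : ℕ → ℝ := fun j => lam * Uy j + (1 - lam) * Uz j with hs₃
  have hJ₃ : ∀ j, s₃ j - s₃ (j + 1) =
      lam * (if j = y then ((y:ℝ) + 1)⁻¹ else 0) + (1 - lam) * (if j = z then ((z:ℝ) + 1)⁻¹ else 0) := by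
    intro j; rw [← hJy j, ← hJz j]; simp only [hs₃]; ring
  -- where the simple triple jumps, `f` jumps
  have P₁ : ∀ j, 0 < s₁ j - s₁ (j + 1) → j = k₁ := fun j hj => by
    by_contra h; rw [hJ₁ j, if_neg h] at hj; exact lt_irrefl _ hj
  have P₂ : ∀ j, 0 < s₂ j - s₂ (j + 1) → j = k₂ := fun j hj => by
    by_contra h; rw [hJ₂ j, if_neg h] at hj; exact lt_irrefl _ hj
  have P₃ : ∀ j, 0 < s₃ j - s₃ (j + 1) → j = y ∨ j = z := fun j hj => by
    by_contra h
    push Not at h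
    rw [hJ₃ j, if_neg h.1, if_neg h.2] at hj; simp at hj
  -- the step size `t`
  classical
  set T : Finset ℝ :=
    ((Finset.range (m + 1)).filter (fun j => 0 < s₁ j - s₁ (j + 1))).image
        (fun j => (f₁ j - f₁ (j + 1)) / (s₁ j - s₁ (j + 1))) ∪
      ((Finset.range (m + 1)).filter (fun j => 0 < s₂ j - s₂ (j + 1))).image
        (fun j => (f₂ j - f₂ (j + 1)) / (s₂ j - s₂ (j + 1))) ∪
      ((Finset.range (m + 1)).filter (fun j => 0 < s₃ j - s₃ (j + 1))).image
        (fun j => (f₃ j - f₃ (j + 1)) / (s₃ j - s₃ (j + 1))) with hT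
  have hk₁pos : 0 < s₁ k₁ - s₁ (k₁ + 1) := by rw [hJ₁ k₁, if_pos rfl]; positivity
  have hTne : T.Nonempty := ⟨_, Finset.mem_union_left _ (Finset.mem_union_left _
    (Finset.mem_image_of_mem _ (Finset.mem_filter.2 ⟨Finset.mem_range.2 hk₁'.1, hk₁pos⟩)))⟩
  set t := T.min' hTne with htdef
  have ht₁ : ∀ j ∈ Finset.range (m + 1), 0 < s₁ j - s₁ (j + 1) →
      t ≤ (f₁ j - f₁ (j + 1)) / (s₁ j - s₁ (j + 1)) := fun j hj hp =>
    Finset.min'_le _ _ (Finset.mem_union_left _ (Finset.mem_union_left _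
      (Finset.mem_image_of_mem _ (Finset.mem_filter.2 ⟨hj, hp⟩))))
  have ht₂ : ∀ j ∈ Finset.range (m + 1), 0 < s₂ j - s₂ (j + 1) →
      t ≤ (f₂ j - f₂ (j + 1)) / (s₂ j - s₂ (j + 1)) := fun j hj hp =>
    Finset.min'_le _ _ (Finset.mem_union_left _ (Finset.mem_union_right _
      (Finset.mem_image_of_mem _ (Finset.mem_filter.2 ⟨hj, hp⟩))))
  have ht₃ : ∀ j ∈ Finset.range (m + 1), 0 < s₃ j - s₃ (j + 1) →
      t ≤ (f₃ j - f₃ (j + 1)) / (s₃ j - s₃ (j + 1)) := fun j hj hp =>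
    Finset.min'_le _ _ (Finset.mem_union_right _
      (Finset.mem_image_of_mem _ (Finset.mem_filter.2 ⟨hj, hp⟩)))
  have htmem : t ∈ T := Finset.min'_mem T hTne
  -- `t` is one of the ratios: record which
  obtain ⟨i₀, j₀, hj₀m, hcase⟩ : ∃ i₀ j₀ : ℕ, j₀ < m + 1 ∧
      ((i₀ = 1 ∧ 0 < s₁ j₀ - s₁ (j₀ + 1) ∧ t * (s₁ j₀ - s₁ (j₀ + 1)) = f₁ j₀ - f₁ (j₀ + 1)) ∨
       (i₀ = 2 ∧ 0 < s₂ j₀ - s₂ (j₀ + 1) ∧ t * (s₂ j₀ - s₂ (j₀ + 1)) = f₂ j₀ - f₂ (j₀ + 1)) ∨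
       (i₀ = 3 ∧ 0 < s₃ j₀ - s₃ (j₀ + 1) ∧ t * (s₃ j₀ - s₃ (j₀ + 1)) = f₃ j₀ - f₃ (j₀ + 1))) := by
    rcases Finset.mem_union.1 htmem with h12 | h3
    · rcases Finset.mem_union.1 h12 with h1 | h2
      · obtain ⟨j₀, hj₀, he⟩ := Finset.mem_image.1 h1
        obtain ⟨hj₀m, hp⟩ := Finset.mem_filter.1 hj₀
        refine ⟨1, j₀, Finset.mem_range.1 hj₀m, Or.inl ⟨rfl, hp, ?_⟩⟩
        rw [← he, div_mul_cancel₀ _ hp.ne']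
      · obtain ⟨j₀, hj₀, he⟩ := Finset.mem_image.1 h2
        obtain ⟨hj₀m, hp⟩ := Finset.mem_filter.1 hj₀
        refine ⟨2, j₀, Finset.mem_range.1 hj₀m, Or.inr (Or.inl ⟨rfl, hp, ?_⟩)⟩
        rw [← he, div_mul_cancel₀ _ hp.ne']
    · obtain ⟨j₀, hj₀, he⟩ := Finset.mem_image.1 h3
      obtain ⟨hj₀m, hp⟩ := Finset.mem_filter.1 hj₀
      refine ⟨3, j₀, Finset.mem_range.1 hj₀m, Or.inr (Or.inr ⟨rfl, hp, ?_⟩)⟩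
      rw [← he, div_mul_cancel₀ _ hp.ne']
  have ht0 : 0 ≤ t := by
    rcases hcase with ⟨-, hp, he⟩ | ⟨-, hp, he⟩ | ⟨-, hp, he⟩
    · have : 0 ≤ f₁ j₀ - f₁ (j₀ + 1) := sub_nonneg.2 (a₁ (Nat.le_succ _))
      nlinarith
    · have : 0 ≤ f₂ j₀ - f₂ (j₀ + 1) := sub_nonneg.2 (a₂ (Nat.le_succ _))
      nlinarith
    · have : 0 ≤ f₃ j₀ - f₃ (j₀ + 1) := sub_nonneg.2 (a₃ (Nat.le_succ _))
      nlinarith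
  -- the residual triple
  obtain ⟨A₁, V₁, S₁, Ma₁, Mo₁⟩ := pair_facts (m := m) a₁ b₁ v₁ u₁ ht0 ht₁
  obtain ⟨A₂, V₂, S₂, Ma₂, Mo₂⟩ := pair_facts (m := m) a₂ b₂ v₂ u₂ ht0 ht₂
  obtain ⟨A₃, V₃, S₃, Ma₃, Mo₃⟩ := pair_facts (m := m) a₃ b₃ v₃ u₃ ht0 ht₃
  have hadm' : Adm[m, fun j => f₁ j - t * s₁ j, fun j => f₂ j - t * s₂ j,
      fun j => f₃ j - t * s₃ j] := by
    refine ⟨A₁, A₂, A₃, V₁, V₂, V₃, ?_, ?_, ?_⟩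
    · rw [Ma₂, Ma₁, M₂, N₂]
    · rw [Ma₃, Ma₁, M₃, N₃]
    · rw [Mo₁, Mo₂, Mo₃, Ma₁]
      linear_combination E - t * F
  have hlt : (Jmp[m, fun j => f₁ j - t * s₁ j]).card + (Jmp[m, fun j => f₂ j - t * s₂ j]).card +
      (Jmp[m, fun j => f₃ j - t * s₃ j]).card <
      (Jmp[m, f₁]).card + (Jmp[m, f₂]).card + (Jmp[m, f₃]).card := by
    have c₁ := Finset.card_le_card S₁
    have c₂ := Finset.card_le_card S₂
    have c₃ := Finset.card_le_card S₃
    rcases hcase with ⟨-, hp, he⟩ | ⟨-, hp, he⟩ | ⟨-, hp, he⟩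
    · have hj : j₀ ∈ Jmp[m, f₁] := by rw [P₁ j₀ hp]; exact hk₁
      have := card_jumps_lt S₁ hj he
      omega
    · have hj : j₀ ∈ Jmp[m, f₂] := by rw [P₂ j₀ hp]; exact hk₂
      have := card_jumps_lt S₂ hj he
      omega
    · have hj : j₀ ∈ Jmp[m, f₃] := by
        rcases P₃ j₀ hp with rfl | rfl
        · exact hy
        · exact hz
      have := card_jumps_lt S₃ hj he
      omega
  obtain ⟨w', hw'⟩ := ih _ _ _ hadm' hlt
  have h := cpl_add hw' hv zero_le_one ht0
  exact ⟨_, cpl_congr h (fun k => by ring) (fun k => by ring) (fun k => by ring)⟩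

/-- **Pebody's Lemma 5 / Corollary 6** (reduction to simple triples): if every simple
admissible triple at level `m` is compatible then every admissible triple at level `m` is
compatible. Induction on the total number of jumps: locate the first and last jumps
`lo_i ≤ hi_i` of the three distributions; since `Σ lo_i ≤ 2m ≤ Σ hi_i` ("changing one of the
parameters at a time over from `min_i` to `max_i`"), one coordinate can carry the two-level part,
and `stepB_core` peels. [cite: Peabody2018, Lemma 5 and Corollary 6] -/
theorem stepB {m : ℕ} (HS : HSm[m]) :
    ∀ f₁ f₂ f₃ : ℕ → ℝ, Adm[m, f₁, f₂, f₃] → ∃ w : ℕ → ℕ → ℕ → ℝ, Cpl[m, f₁, f₂, f₃, w] := by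
  suffices H : ∀ N : ℕ, ∀ f₁ f₂ f₃ : ℕ → ℝ, Adm[m, f₁, f₂, f₃] →
      (Jmp[m, f₁]).card + (Jmp[m, f₂]).card + (Jmp[m, f₃]).card ≤ N →
      ∃ w : ℕ → ℕ → ℕ → ℝ, Cpl[m, f₁, f₂, f₃, w] by
    intro f₁ f₂ f₃ h; exact H _ f₁ f₂ f₃ h le_rfl
  intro N
  induction N with
  | zero =>
    intro f₁ f₂ f₃ hadm hN
    have hJ : Jmp[m, f₁] = ∅ := Finset.card_eq_zero.1 (by omega)
    exact cpl_of_mass_zero hadm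
      (Finset.sum_eq_zero fun k _ => eq_zero_of_jumps_empty hadm.1 hadm.2.2.2.1 hJ k)
  | succ N IH =>
    intro f₁ f₂ f₃ hadm hN
    by_cases hM : Mass[m, f₁] = 0
    · exact cpl_of_mass_zero hadm hM
    obtain ⟨a₁, a₂, a₃, v₁, v₂, v₃, M₂, M₃, E⟩ := hadm
    have hn₁ := nonneg_of_antitone_of_vanish a₁ v₁
    have hMpos : 0 < Mass[m, f₁] :=
      lt_of_le_of_ne (Finset.sum_nonneg fun k _ => hn₁ k) (Ne.symm hM)
    -- all three jump sets are nonempty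
    have ne₁ : (Jmp[m, f₁]).Nonempty := by
      rw [Finset.nonempty_iff_ne_empty]; intro hJ
      exact hM (Finset.sum_eq_zero fun k _ => eq_zero_of_jumps_empty a₁ v₁ hJ k)
    have ne₂ : (Jmp[m, f₂]).Nonempty := by
      rw [Finset.nonempty_iff_ne_empty]; intro hJ
      exact hM (M₂ ▸ Finset.sum_eq_zero fun k _ => eq_zero_of_jumps_empty a₂ v₂ hJ k)
    have ne₃ : (Jmp[m, f₃]).Nonempty := by
      rw [Finset.nonempty_iff_ne_empty]; intro hJ
      exact hM (M₃ ▸ Finset.sum_eq_zero fun k _ => eq_zero_of_jumps_empty a₃ v₃ hJ k)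
    -- first and last jumps, and the moment bounds `lo · M ≤ 2 Mom ≤ hi · M`
    have key : ∀ {f : ℕ → ℝ}, Antitone f → (∀ k, m < k → f k = 0) → (ne : (Jmp[m, f]).Nonempty) →
        (Jmp[m, f]).min' ne ∈ Jmp[m, f] ∧ (Jmp[m, f]).max' ne ∈ Jmp[m, f] ∧
        (((Jmp[m, f]).min' ne : ℕ) : ℝ) * Mass[m, f] ≤ 2 * Mom[m, f] ∧
        2 * Mom[m, f] ≤ (((Jmp[m, f]).max' ne : ℕ) : ℝ) * Mass[m, f] := by
      intro f hf hs ne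
      have hmin := Finset.min'_mem _ ne
      have hmax := Finset.max'_mem _ ne
      have hmin' := hmin; have hmax' := hmax
      simp only [Finset.mem_filter, Finset.mem_range] at hmin' hmax'
      refine ⟨hmin, hmax, ?_, ?_⟩
      · refine lo_mul_mass_le hf hs (by omega)
          (eq_of_lt_min_jump (m := m) hf (lo := (Jmp[m, f]).min' ne) (fun j hj hjm hlt => ?_)
            (by omega))
        have : (Jmp[m, f]).min' ne ≤ j :=
          Finset.min'_le _ _ (Finset.mem_filter.2 ⟨Finset.mem_range.2 (by omega), hlt⟩)
        omega
      · refine two_mul_mom_le hf (by omega) (eq_zero_of_max_jump_lt hf hs fun j hj hjm hlt => ?_)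
        have : j ≤ (Jmp[m, f]).max' ne :=
          Finset.le_max' _ _ (Finset.mem_filter.2 ⟨Finset.mem_range.2 (by omega), hlt⟩)
        omega
    obtain ⟨lo₁, hi₁, blo₁, bhi₁⟩ := key a₁ v₁ ne₁
    obtain ⟨lo₂, hi₂, blo₂, bhi₂⟩ := key a₂ v₂ ne₂
    obtain ⟨lo₃, hi₃, blo₃, bhi₃⟩ := key a₃ v₃ ne₃
    rw [M₂] at blo₂ bhi₂
    rw [M₃] at blo₃ bhi₃
    set L₁ := (Jmp[m, f₁]).min' ne₁; set H₁ := (Jmp[m, f₁]).max' ne₁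
    set L₂ := (Jmp[m, f₂]).min' ne₂; set H₂ := (Jmp[m, f₂]).max' ne₂
    set L₃ := (Jmp[m, f₃]).min' ne₃; set H₃ := (Jmp[m, f₃]).max' ne₃
    have hLH₁ : L₁ ≤ H₁ := Finset.min'_le _ _ hi₁
    have hLH₂ : L₂ ≤ H₂ := Finset.min'_le _ _ hi₂
    have hLH₃ : L₃ ≤ H₃ := Finset.min'_le _ _ hi₃
    have hlosum : (L₁:ℝ) + L₂ + L₃ ≤ 2 * m := by
      by_contra h
      push Not at h
      nlinarith
    have hhisum : 2 * (m:ℝ) ≤ (H₁:ℝ) + H₂ + H₃ := by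
      by_contra h
      push Not at h
      nlinarith
    have hadm : Adm[m, f₁, f₂, f₃] := ⟨a₁, a₂, a₃, v₁, v₂, v₃, M₂, M₃, E⟩
    by_cases c3 : (H₁:ℝ) + H₂ + L₃ ≤ 2 * m
    · exact stepB_core HS hadm (fun g₁ g₂ g₃ hg hlt => IH g₁ g₂ g₃ hg (by omega)) hi₁ hi₂ lo₃ hi₃
        hLH₃ (by linarith) (by linarith)
    · by_cases c2 : (H₁:ℝ) + L₂ + L₃ ≤ 2 * m
      · obtain ⟨w, hw⟩ := stepB_core HS (adm_swap23 hadm)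
          (fun g₁ g₂ g₃ hg hlt => IH g₁ g₂ g₃ hg (by omega)) hi₁ lo₃ lo₂ hi₂ hLH₂ (by linarith)
          (by push Not at c3; linarith)
        exact ⟨_, cpl_swap23 hw⟩
      · obtain ⟨w, hw⟩ := stepB_core HS (adm_swap23 (adm_swap12 hadm))
          (fun g₁ g₂ g₃ hg hlt => IH g₁ g₂ g₃ hg (by omega)) lo₂ lo₃ lo₁ hi₁ hLH₁ (by linarith)
          (by push Not at c2; linarith)
        exact ⟨_, cpl_swap23 (cpl_swap13 hw)⟩

/-- **Pebody's Theorem 4** (unnormalised, functional form): three decreasing nonnegative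
functions on `[0, m]` with equal masses and moments summing to `m ·` mass are compatible, i.e.
they are the marginals of a nonnegative weight on the triples `a + b + c = m`. Induction on `m`
(§5): Corollary 8 from level `m`, the simple triples at level `m + 1` (`simple_of_cor8`), and the
reduction `stepB`. [cite: Peabody2018, Theorem 4] -/
theorem theorem4 (m : ℕ) :
    ∀ f₁ f₂ f₃ : ℕ → ℝ, Adm[m, f₁, f₂, f₃] → ∃ w : ℕ → ℕ → ℕ → ℝ, Cpl[m, f₁, f₂, f₃, w] := by
  induction m with
  | zero =>
    refine stepB (m := 0) ?_
    intro k l y z lam hk hl hyz hz h0 h1 hsum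
    obtain ⟨rfl, rfl, rfl, rfl⟩ : k = 0 ∧ l = 0 ∧ y = 0 ∧ z = 0 := by omega
    obtain ⟨w, hw⟩ := cpl_uniform_uniform_zero 0
    exact ⟨_, cpl_congr hw (fun j => rfl) (fun j => rfl) (fun j => by ring)⟩
  | succ m IHm =>
    refine stepB (m := m + 1) ?_
    intro k l y z lam hk hl hyz hz h0 h1 hsum
    refine simple_of_cor8 (L := m + 1) (fun f₁ f₂ f₃ hadm h₂ h₃ => cor8 IHm ?_ h₂ h₃)
      hk hl hyz hz h0 h1 hsum
    obtain ⟨a, b, c, d, e, f, g, h, i⟩ := hadm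
    exact ⟨a, b, c, d, e, f, g, h, by push_cast at i ⊢; linarith⟩

/-- **Kleinberg–Sawin–Speyer 2018, Theorem 4** ([Norin], [Pebody]; the case `π₁ = π₂ = π₃` of
Pebody's Theorem 4): a decreasing nonnegative `ψ` on `[0, m]` with mean `m/3`
(`3 Σ k ψ(k) = m Σ ψ(k)`) is the common marginal of a nonnegative weight on the triples
`{(a, b, c) : a + b + c = m}`. (Symmetrising the weight under `S₃` gives the printed
`S₃`-symmetric distribution.) [cite: Peabody2018, Theorem 4] -/
theorem exists_coupling_of_antitone (m : ℕ) (ψ : ℕ → ℝ) (hψ : Antitone ψ)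
    (hv : ∀ k, m < k → ψ k = 0)
    (hmom : 3 * ∑ k ∈ Finset.range (m + 1), (k:ℝ) * ψ k = m * ∑ k ∈ Finset.range (m + 1), ψ k) :
    ∃ w : ℕ → ℕ → ℕ → ℝ, (∀ a b c, 0 ≤ w a b c) ∧ (∀ a b c, a + b + c ≠ m → w a b c = 0) ∧
      (∀ a, ∑ b ∈ Finset.range (m + 1), ∑ c ∈ Finset.range (m + 1), w a b c = ψ a) ∧
      (∀ b, ∑ a ∈ Finset.range (m + 1), ∑ c ∈ Finset.range (m + 1), w a b c = ψ b) ∧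
      (∀ c, ∑ a ∈ Finset.range (m + 1), ∑ b ∈ Finset.range (m + 1), w a b c = ψ c) :=
  theorem4 m ψ ψ ψ ⟨hψ, hψ, hψ, hv, hv, hv, rfl, rfl, by linarith⟩

end Pebody


end Literature.Combinatorics.Additive
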